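import Literature.MathematicalPhysics.QuantumFieldTheory.Balaban1983to89.B4TwoBox120
import Literature.MathematicalPhysics.QuantumFieldTheory.Balaban1983to89.B1RG242

/-!
# `Balaban1983to89.B4Thm110ZeroBox` — B4 «Theorem (Proposition 2.1 of [1])», the VALUE CLAUSE of (1.10), PROVED at
# `A = 0` on RECTANGULAR PARALLELEPIPEDS for ALL scales `k ≥ 1`: `|(G_k(□)f)(x)| ≤ c₀e^{−δ₀dist(x, supp f)}‖f‖_∞`,
# `G_k(□) = (−Δ^{η,N}_□ + m² + a_kP_k)^{-1}`, `η = L^{-k}`, by the print's own box route (2.34) + Lemma 2.4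

**Source.** T. Bałaban, *Regularity and Decay of Lattice Green's Functions*, Commun. Math. Phys. **89**, 571–597 (1983)
(bib key `Balaban1983RegularityDecay`, «B4» of the 1983–89 series): p. 572 [PDF 2] (1.3)–(1.6), p. 573 [PDF 3] the
Theorem with (1.9)–(1.12), pp. 577–578 [PDF 7–8] Lemma 2.2 (2.16)–(2.17), pp. 581–582 [PDF 11–12] the reduction to
`G_k(□, 0)` and (2.34), Lemma 2.4 (2.35)–(2.37), p. 584 [PDF 14] (2.44) (journal page = PDF page + 570; renders
`b2b-balaban-ref1/pages/1983-cmp89-regularity-decay/1983-cmp89-regularity-decay-p002-x2.png`, `-p003`, `-p007`, `-p008`,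
`-p011`, `-p012`, `-p014-x2.png`, read as images); and T. Bałaban, *(Higgs)₂,₃ quantum fields in a finite volume. I*,
Commun. Math. Phys. **85**, 603–636 (1982) (bib key `Balaban1982Higgs1`, «B1»), (2.15) p. 609 (the running `a_k`) and
(2.42)–(2.43) p. 612 (the renormalization group equations), as typed in `B1`/`B1RG242`.  A new leaf next to
`B4TwoBox120`/`B4BoxCov237` ((2.35)/(2.37) for boxes) and `B1RG242` ((2.42) as an algebraic identity); no existing module is touched;
nothing of B4 is asserted as a fact.

## WHAT IS PRINTED (verbatim; `≦` of the print written `≤`)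

p. 572: «We consider operators on subsets of the lattice ηZ^d, η = L^{−k}. Here L is a small positive integer > 1,
e.g. L = 2 or 3, and k is an arbitrary positive integer.» […] «⟨φ, (−Δ^{η,N}_{A,Ω})φ⟩ = Σ_{b⊂Ω} η^d|(D^η_Aφ)(b)|²
= Σ_{b⊂Ω} η^d|η^{−1}(U(A_b)φ(b₊) − φ(b₋))|²,   (1.3)» […] «(Q_k(A)φ)(y) = Σ_{x∈B^k(y)} η^dU(A(Γ^{(k)}_{y,x}))φ(x),
y ∈ Z^d,   (1.4)» […] «P_k(A) = Q_k^*(A)Q_k(A).   (1.5)» […] «G_k(Ω, A) = (−Δ^{η,N}_{A,Ω} + m² + aP_k(A))^{−1},   (1.6)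
where m² ≥ 0 and a is a positive constant close to 1».

p. 573: «**Theorem** (Proposition 2.1 of [1]). For α < 1 there exist positive constants δ₀, c₀, R₀ independent of
A, k, Ω and depending on d, M only, c₀ on α also, such that for e sufficiently small and for an arbitrary function
f : Ω → R^N, we have
(1/|x − x′|^α)|U(A(Γ_{x,x′}))(D^η_{A,μ}G_k(Ω, A)f)(x′) − (D^η_{A,μ}G_k(Ω, A)f)(x)| ≤ c₀ exp(−δ₀ dist({x, x′}, supp f))‖f‖_∞
(1.9)  for x, x′ ∈ Ω, and satisfying the condition dist({x, x′}, Ω^c) ≥ R₀. Similarly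
|(D^η_{A,μ}G_k(Ω, A)f)(x)|, |(G_k(Ω, A)(x)| ≤ c₀ exp(−δ₀ dist(x, supp f))‖f‖_∞   (1.10)
for x ∈ Ω, dist(x, Ω^c) ≥ R₀.» [sic: «|(G_k(Ω, A)(x)|» for `|(G_k(Ω, A)f)(x)|`] «If Ω ⊂ Ω₀, then for δG_k(Ω, Ω₀, A)
defined by the equality δG_k(Ω, Ω₀, A) = G_k(Ω, A) − G_k(Ω₀, A),   (1.11)  we have the inequalities (1.5) and (1.6)
(with the same restrictions on x, x′) with the additional factor exp(−δ₀ dist(supp f, Ω^c) − δ₀ dist(supp f, Ω^c))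
(1.12) on the right hand sides. For some simple sets Ω, e.g. for rectangular parallelepipeds, the inequalities hold
without any restrictions on the points x, x′, i.e. for all x, x′ ∈ Ω.»

pp. 577–578: «**Lemma 2.2.** Let a rectangular parallelepiped □ be a sum of few large blocks (e.g., as in the case of
the cubes □_j), and let Ã be a regular vector field configuration in the sense of Proposition I.2.1, constant in a
neighbourhood of the boundary of □. Then for e sufficiently small and α < 1, there exists a constant c₁ depending on
d, α only, such that ‖G_k(□, Ã)f‖_{1,α} ≤ c₁‖f‖_∞,   (2.16)  and a constant c₂ depending on d, p₁, such that
‖G_k(□, Ã)f‖_q, ‖D^η_{Ã,μ}G_k(□, Ã)f‖_q, ‖G_k(□, Ã)D^{η*}_{Ã,μ}f‖_q ≤ c₂‖f‖_p   (2.17)  for 1 ≤ p, q ≤ ∞, satisfying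
the condition 1/p − 1/p₁ ≤ 1/q ≤ 1/p with p₁ > d.» (with, p. 577 (2.14), ‖f‖_{1,α} = max{sup_x|f(x)|, …}).

pp. 581–582: «Lemma 2.2 in the case of a constant configuration A₀ is equivalent to the case of configuration A₀ = 0
by the same argument with the gauge transformation as before. Thus we have reduced the proof of this lemma to a proof
of the corresponding properties for the propagator G_k(□, 0), or to the one-component propagator G_k(□)
[G_k(□, 0) = G_k(□)1, 1 is identity operator on R^N]. This proof is based on renormalization group equations (2.43)
of [1] rescaled to the η-lattice:
G_k(□) = C^{(0),η}(□) + Σ_{j=1}^{k−1} a_j²(L^jη)^{−4}G_j^η(□)Q_j^*C^{(j),L^jη}(□)Q_jG_j^η(□).   (2.34)» […]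
«**Lemma 2.4.** There exist positive constants c₀, δ₀, and for α < 1, there exists a constant c₁, such that
|(G_j(□)Q_j^*)(x, y)|, |(∂^{L^{−j}}_μG_j(□)Q_j^*)(x, y)| ≤ c₀e^{−δ₀|x−y|},   (2.35) […]
|C^{(j)}(□; y, y′)| ≤ c₀e^{−δ₀|y−y′|},   (2.37)  for arbitrary non-negative integer j, arbitrary, rectangular
parallelepiped □ ⊂ L^{−j}Z^d built of large blocks, and x, x′ ∈ □, y, y′ ∈ □^{(j)} = □∩Z^d.»

p. 584: «This part of the argument is valid for an arbitrary rectangular parallelepiped □ built of unit blocks, so the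
inequalities are valid for all such sets.» […] «We apply it to the basic equation (−Δ^ξ + m_j² + a_jQ_j^*Q_j)φ₀ = f.
(2.44)»

## WHAT THIS FILE CERTIFIES (kernel-checked, zero `sorry`, no hypotheses; the lineage is USED BY NAME, not re-proved)

For every dimension `d + 1`, every `L = ℓ + 1 ≥ 2` and every window `a ∈ [a₋, a₊]` (`a₋ > 0`), `m² ∈ [0, m²₊]`
there are `δ₀ > 0`, `c₀ > 0` such that for EVERY scale `k ≥ 1` (`η = L^{-k}`), every `(a, m²)` in the window,
every box `□ = Π_μ[0, M_μ)` with integer sides `M_μ ≥ 1` (a «rectangular parallelepiped built of unit blocks»), the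
propagator `G = G_k(□) = (−Δ^{η,N}_□ + m² + a_kP_k(0))^{-1}` on `□ ∩ ηℤ^{d+1}` (the REAL matrix inverse of
`B4BoxCov237.boxOpR (L^k) a_k m² M`, which IS its two-sided inverse, `B4BoxCov237.boxOpR_mul_inv/inv_mul`) obeys
* `thm110_zero_box_roww` (§10, the master estimate): `Σ_{x′} |G(x, x′)|·e^{δ₀η|x−x′|_∞} ≤ c₀` for every `x ∈ □`;
* `thm110_zero_box_value` / `thm110_zero_box_dist` (§11) — **THE VALUE CLAUSE OF (1.10) for rectangular
  parallelepipeds, with no restriction on `x`**: `|(Gf)(x)| ≤ c₀·e^{−δ₀ηD}·F` for every `f`, every `F ≥ |f|`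
  pointwise and every `D ≤ |x − x′|_∞ (x′ ∈ supp f)`, in particular for `D = dsupp f x`, the `ℓ^∞`-distance from `x`
  to `supp f` (`ηD = dist_η(x, supp f)`);
* `lemma22_zero_box_rowSum` / `…_colSum` / `…_sup` (§11) — **LEMMA 2.2 (2.17) AT `A = 0` FOR `p = q = ∞` AND
  `p = q = 1`** and the `sup|·|`-part of (2.16): `Σ_{x′}|G(x,x′)| ≤ c₀`, `Σ_{x}|G(x,x′)| ≤ c₀`, `‖Gf‖_∞ ≤ c₀‖f‖_∞`;
* `thm110_zero_box_roww_coeff` / `thm110_zero_box_value_coeff` (§11) — the same two statements for the operator with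
  the LITERAL coefficient `a` of (1.6) ranging over the window (instead of the running `a_k = B1.aSeq a L k`);
* §12: the statements are instantiated at `d + 1 = 4`, `L = 2`, `a ∈ [1/2, 2]`, `m² ∈ [0, 1]` and their binders are
  inhabited (`k = 1`, the unit cube), so nothing is vacuous.
On the way (§§4–9, all at `A = 0` on the box, for every `1 ≤ j ≤ k`): the scale-`j` operators
`𝒟_j = −Δ^η + m² + a_j(L^jη)^{-2}P_j` on the fine box and their propagators `𝒢_j = 𝒟_j^{-1}` (`fineOp`, `Gfine`;
`𝒢_k = G_k(□)`, `fineOp_top`), their identification with rescaled copies of `boxOpR` (`fineOp_eq`, `Gfine_apply`), the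
renormalization group equation (2.34) ONE STEP AT A TIME as a kernel identity
`𝒢_{j+1} − 𝒢_j = α_j²·(𝒢_jQ_j^*)·C_j·(Q_j𝒢_j)` (`Gfine_succ`, `Gfine_succ_sub`: `B1RG242.StepData.display242` on the
box, with `C_j = s_j^{-2}·(B4BoxCov237.covOp …)⁻¹`, `Cmat`), the block-row form of (2.35) (`Gfine_blockRow_bound`, from
`B4TwoBox120.green_blockRow_bound`, i.e. `B4Green242Bridge.greenBoxQ_decay_235_inv`), (2.37) (`B4BoxCov237.cov237_box_decay`), the decay of the one-step box Green's function
(`boxOpR_L_inv_decay`, §7, from the Section-5 theorem `B4Sect5Torus.inv_decay` via coercivity from the block Poincaré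
inequality `Beta.BlockPoincare.coercive_of_blockPoincare` and condition (5.6)), the step bound in the weighted row norm
with the geometric factor `L^{-2(k−j)}` (`step_term_bound`, §8) and the induction over `j` (`Gfine_roww_bound`, §9).

## DICTIONARY (typist's; each line is a reading, not a quotation; everything at `A = 0`, `U ≡ 1`, one component)

* `ηZ^d ∩ □`, `η = L^{-k}` ↦ the fine box `boxDom (fun i => (ℓ+1)^k * M i) ⊂ ℤ^{d+1}` in LATTICE UNITS (site `x`
  ↔ point `ηx`), `L = ℓ + 1 ≥ 2`, `k ≥ 1`, `□ = Π_μ[0, M_μ)` with `M_μ ∈ ℕ`, `M_μ ≥ 1` (`B4Reflection242.boxDom`,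
  half-open); `□^{(j)}`, `□ ∩ L^jηZ^d` ↦ `boxDom (Mj ℓ k M j)`, blocks `B^j(y)` ↦ `B4Reflection242.blk (bj ℓ j)`.
* `−Δ^{η,N}_{0,□} + m² + a_kP_k(0)` ((1.3)–(1.6) at `A = 0`; B4 §2 writes the running constants `m_k²`, `a_k`, (2.24),
  (2.44)) ↦ `B4BoxCov237.boxOpR ((ℓ+1)^k) a_k m2 M = n²·(−Δ^N_□,unit) + m2·1 + a_k·n^{-(d+1)}·1_{same n-block}`,
  `n = L^k` — the operator's kernel with respect to counting measure on sites (the `η^d` of (1.3)/(1.4) cancel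
  between the form and the `ℓ²_η` pairing; `P_k(0)(x, x′) = η^{d+1}·1_{B^k(x) = B^k(x′)}`); `G_k(□) = G_k(□, 0)`
  restricted to one component (p. 582) ↦ `(boxOpR …)⁻¹` (`Matrix.inv`; a genuine inverse since `a_k > 0`, `m² ≥ 0`);
  `(G_k(□)f)(x)` ↦ `((boxOpR …)⁻¹ *ᵥ f) x`.
* `a` of (1.6) ↦ `a_k = B1.aSeq a ((ℓ:ℝ)+1) k = a(1 − L^{-2})/(1 − L^{-2k})` (B1 (2.15); `a_1 = a`), `a` ranging over
  the window — the §2 convention of the print; AND literally `a` itself in `thm110_zero_box_roww_coeff` /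
  `thm110_zero_box_value_coeff` (`aSeq (a/c_k) L k = a`, `c_k ∈ [1 − L^{-2}, 1]`, §11).
* `‖f‖_∞` ↦ any `F` with `|f x′| ≤ F` for all `x′`; `dist(x, supp f)` ↦ `η·D` for any `D ≤ |x − x′|_∞` on `supp f`,
  literally `η·dsupp f x`, `dsupp f x = inf{|x − x′|_∞ : f x′ ≠ 0}` (junk `0` for `f = 0`, when the bound reads
  `|(Gf)(x)| ≤ c₀F`); `|x − x′|` ↦ the sup norm `B4ContourShift.supNorm` in lattice units divided by `n = L^k` (the
  print's Euclidean distance is `≥` the sup distance, so the printed exponent follows with `δ₀/√(d+1)`).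
* (2.34) ↦ the telescoped identities `Gfine_succ` (`1 ≤ j ≤ k − 1`): `𝒢_{j+1} = α_j²·𝒢_jQ_j^*·C_j·Q_j𝒢_j + 𝒢_j` with
  `α_j = a_j·s_j²` (`αj`; `s_j = L^{k−j} = (L^jη)^{-1}`, `sc`), `Q_j`, `Q_j^*` the block-averaging matrices of §3
  (`QkM`, `QksM`) and `C_j = s_j^{-2}·C^{(j)}(□)`, `C^{(j)}(□) = (B4BoxCov237.covOp (bj ℓ j) ℓ a_j a (m²/s_j²) (Mp …))⁻¹`
  (`Cmat`) — the powers of `L^jη` are distributed between `α_j`, `Q_j`, `Q_j^*`, `C_j` by the values-form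
  normalisation of `B1RG242.StepData` (under which the identity is KERNEL-PROVED, `display242`), not by the print's
  `ℓ²_η` one; the `j = 1` start `𝒢_1` (the analogue of `C^{(0),η}(□)`) is a rescaled one-step box Green's function
  (`Gfine_apply`, `boxOpR_L_inv_decay`).
* «constants depending on d, M only» ↦ `∃ δ₀ c₀` depending on `d`, `ℓ` and the window `[a₋, a₊] × [0, m²₊]` only —
  uniform in `k ≥ 1`, in the box and in `(a, m²)`.

## HONEST SCOPE — what is NOT certified here

(i) Only `A = 0`: `U ≡ 1`, the covariant derivative is the plain difference, «e sufficiently small» and the regularity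
condition (1.7) have no content, and only the one-component propagator `G_k(□)` of p. 582 appears (`G_k(□, 0) =
G_k(□)1`).  (ii) Only `Ω = □` a rectangular parallelepiped `Π_μ[0, M_μ)` with integer sides (unions of UNIT blocks, as
on p. 584; the big-block structure «sum of few large blocks» of Lemma 2.2 is not needed at `A = 0` and not imposed) —
the print's clause «for rectangular parallelepipeds … for all x»; general unions of big blocks `Ω` with the restriction
`dist(x, Ω^c) ≥ R₀`, i.e. the random-walk expansion (2.12)–(2.13) of the print's Sect. 2, are NOT treated.  (iii) Only
the VALUE clause `|(G_k f)(x)|` of (1.10) and the cases `p = q ∈ {1, ∞}` of (2.17) for `G_k` itself: the derivative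
clause `|(D^η_μG_kf)(x)|`, the Hölder estimate (1.9)/(2.16), the `L^p → L^q` scale of (2.17), the operators
`D^ηG_k`, `G_kD^{η*}`, and (1.11)–(1.12) (`δG_k`, certified separately at `A = 0` in `B4Cor23ZeroDelta` for the `L²`
Corollary 2.3) are NOT treated.  (iv) The constants are existential and depend on `d`, `ℓ` (the print's silent
`L`-dependence) and on the WINDOW of `(a, m²)` (print: «depending on d, M only», with `a` «close to 1» and `m² ≥ 0`
fixed) — the window is the package's reading of the running constants; no numerical value is claimed, and the decay
rate is `δ₀` per unit of `η`-scaled sup distance.  (v) Sup norm instead of the Euclidean norm (equivalent up to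
`√(d+1)` in `δ₀`).  (vi) ROUTE: the proof is the print's box route of pp. 582–584 — (2.34) with Lemma 2.4 — carried
out at `A = 0` with the package's kernel theorems as inputs ((2.42)/(2.43) of [1] = `B1RG242.StepData.display242`;
(2.35) in block-row form from `B4TwoBox120.green_blockRow_bound` (`B4Green242Bridge`) and (2.37) from
`B4BoxCov237.cov237_box_decay`, which rests on the Section-5 theorem `B4Sect5Torus.inv_decay`; the `j = 1` start from the same Section-5 theorem applied to the one-step box operator) —
it is NOT the print's general proof of the Theorem (Sect. 2–3, random walk expansion and Fourier analysis (2.45) ff.),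
and Lemma 2.4's pointwise (2.35)/(2.36) are used only through the block-row sums that (2.34) needs.  (vii) This file
does not touch `DagBinding`/`DagDischarged` (the carver's) nor `B4Prop31Zero`; whether and how the abstract
`B4.ThmPrinted` of the binding is instantiated from it is the carver's call.

**Value = kernel certificate (the print's (1.10) value clause at `A = 0` on boxes, all scales, by the print's own
renormalization-group route over the package's `A = 0` theorems), NOT summit progress**: the Yang–Mills /
`Summit.QuantumFields` statements are untouched; no Literature fact is minted — every hypothesis used is kernel-proved
in this package.
-/

namespace Literature.MathematicalPhysics.QuantumFieldTheory.Balaban1983to89.B4Thm110ZeroBox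

open Finset Matrix
open Literature.MathematicalPhysics.QuantumFieldTheory.Balaban1983to89.B4ContourShift
open Literature.MathematicalPhysics.QuantumFieldTheory.Balaban1983to89.B4Reflection242
open Literature.MathematicalPhysics.QuantumFieldTheory.Balaban1983to89.B4Green242Bridge
open Literature.MathematicalPhysics.QuantumFieldTheory.Balaban1983to89.B4BoxCov237
open B4Sect5Torus (IsPseudoDist SumBound Hyp56 rate rate_pos inv_decay)
open B4Sect5Proof (latticeConst latticeConst_nonneg latticeSum_le)

noncomputable section

variable {d : ℕ}

/-! ## §1 Casts between boxes with equal side functions -/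

/-- the identity map between the boxes of two (propositionally) equal side functions. [folklore] -/
def boxCast {N N' : Fin (d + 1) → ℕ} (h : N = N') : ↥(boxDom N) ≃ ↥(boxDom N') :=
  Equiv.subtypeEquivRight fun x => by rw [h]

/-- the cast preserves the underlying lattice point. [folklore] -/
@[simp] theorem boxCast_apply_val {N N' : Fin (d + 1) → ℕ} (h : N = N') (x : ↥(boxDom N)) :
    (boxCast h x).1 = x.1 := rfl

/-- the inverse cast preserves the underlying lattice point. [folklore] -/
@[simp] theorem boxCast_symm_apply_val {N N' : Fin (d + 1) → ℕ} (h : N = N') (x : ↥(boxDom N')) :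
    ((boxCast h).symm x).1 = x.1 := rfl

/-- the real box operator is transported by the cast (its entries only depend on the lattice points and on the
box as a set). [folklore] -/
theorem opBoxR_boxCast {N N' : Fin (d + 1) → ℕ} (h : N = N') (c₁ msq a : ℝ) (b : ℕ) (x y : ↥(boxDom N')) :
    opBoxR c₁ msq a b N' x y = opBoxR c₁ msq a b N ((boxCast h).symm x) ((boxCast h).symm y) := by
  subst h
  rfl

/-- membership transported along an equality of side functions. [folklore] -/
theorem mem_boxDom_of_eq {N N' : Fin (d + 1) → ℕ} (h : N = N') {x : Fin (d + 1) → ℤ} (hx : x ∈ boxDom N) :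
    x ∈ boxDom N' := h ▸ hx

/-! ## §2 The scales: `L = ℓ + 1`, `η = L^{-k}`, block sides `b_j = L^j`, scale factors `s_j = L^{k-j} = (L^jη)^{-1}` -/

/-- the fine box `□ ∩ ηℤ^{d+1}` in lattice units: `L^k·M_μ` sites per side (`η = L^{-k}`, `□ = Π[0, M_μ)`).
[cite: Balaban1983RegularityDecay, p. 572 (1.3)–(1.6), p. 582 (2.34), dictionary] [folklore] -/
abbrev Nf (ℓ k : ℕ) (M : Fin (d + 1) → ℕ) : Fin (d + 1) → ℕ := fun i => (ℓ + 1) ^ k * M i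

/-- the unit-lattice box `□^{(j+1)}` of scale `j + 1` in `L^{j+1}η`-units: `L^{k-j-1}·M_μ` sites per side. [folklore] -/
abbrev Mp (ℓ k : ℕ) (M : Fin (d + 1) → ℕ) (j : ℕ) : Fin (d + 1) → ℕ := fun i => (ℓ + 1) ^ (k - j - 1) * M i

/-- the box `□^{(j)}` of scale `j` in `L^jη`-units, written as `L·M'` (`M' = Mp`): `L^{k-j}·M_μ` sites per side. [folklore] -/
abbrev Mj (ℓ k : ℕ) (M : Fin (d + 1) → ℕ) (j : ℕ) : Fin (d + 1) → ℕ := fun i => (ℓ + 1) * Mp ℓ k M j i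

/-- the block side `b_j = L^j` (fine sites per `L^jη`-block and direction). [folklore] -/
abbrev bj (ℓ j : ℕ) : ℕ := (ℓ + 1) ^ j

/-- the scale factor `s_j = L^{k-j} = (L^jη)^{-1}`. [folklore] -/
def sc (ℓ k j : ℕ) : ℝ := ((ℓ : ℝ) + 1) ^ (k - j)

/-- `L = ℓ + 1 ≥ 1`. [folklore] -/
theorem one_le_L (ℓ : ℕ) : 1 ≤ ℓ + 1 := by omega

/-- `L = ℓ + 1 > 0` in `ℝ`. [folklore] -/
theorem L_real_pos (ℓ : ℕ) : (0 : ℝ) < (ℓ : ℝ) + 1 := by positivity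

/-- `L = ℓ + 1 > 1` in `ℝ` for `ℓ ≥ 1`. [folklore] -/
theorem one_lt_L_real {ℓ : ℕ} (hℓ : 1 ≤ ℓ) : (1 : ℝ) < (ℓ : ℝ) + 1 := by
  have : (1 : ℝ) ≤ ℓ := by exact_mod_cast hℓ
  linarith

/-- `b_j = L^j ≥ 1`. [folklore] -/
theorem bj_pos (ℓ j : ℕ) : 1 ≤ bj ℓ j := Nat.one_le_pow _ _ (by omega)

/-- `b_j = L^j` cast to `ℝ`. [folklore] -/
theorem bj_cast (ℓ j : ℕ) : (bj ℓ j : ℝ) = ((ℓ : ℝ) + 1) ^ j := by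
  simp [bj]

/-- `s_j > 0`. [folklore] -/
theorem sc_pos (ℓ k j : ℕ) : 0 < sc ℓ k j := by
  unfold sc; positivity

/-- `s_j ≥ 1`. [folklore] -/
theorem one_le_sc (ℓ k j : ℕ) : 1 ≤ sc ℓ k j := by
  unfold sc
  exact one_le_pow₀ (le_add_of_nonneg_left (Nat.cast_nonneg ℓ))

/-- `s_j · b_j = L^k` (`j ≤ k`). [folklore] -/
theorem sc_mul_bj {ℓ k j : ℕ} (hj : j ≤ k) : sc ℓ k j * (bj ℓ j : ℝ) = ((ℓ : ℝ) + 1) ^ k := by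
  rw [sc, bj_cast, ← pow_add, Nat.sub_add_cancel hj]

/-- `s_j = L · s_{j+1}` (`j + 1 ≤ k`). [folklore] -/
theorem sc_eq_succ {ℓ k j : ℕ} (hj : j + 1 ≤ k) : sc ℓ k j = ((ℓ : ℝ) + 1) * sc ℓ k (j + 1) := by
  rw [sc, sc, ← pow_succ']
  congr 1
  omega

/-- `s_k = 1`. [folklore] -/
theorem sc_self (ℓ k : ℕ) : sc ℓ k k = 1 := by simp [sc]

/-- the fine box is the scale-`j` box refined by `b_j`-blocks: `b_j · (L · Mp_j) = L^k · M` (`j + 1 ≤ k`). [folklore] -/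
theorem Nf_eq_bj_Mj {ℓ k j : ℕ} (hj : j + 1 ≤ k) (M : Fin (d + 1) → ℕ) :
    (fun i => bj ℓ j * Mj ℓ k M j i) = Nf ℓ k M := by
  funext i
  simp only [bj, Mj, Mp, Nf]
  rw [← mul_assoc, ← mul_assoc, ← pow_succ, ← pow_add]
  congr 2
  omega

/-- the fine box is the scale-`(j+1)` box refined by `b_{j+1}`-blocks: `b_{j+1} · Mp_j = L^k · M` (`j + 1 ≤ k`). [folklore] -/
theorem Nf_eq_bj_Mp {ℓ k j : ℕ} (hj : j + 1 ≤ k) (M : Fin (d + 1) → ℕ) :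
    (fun i => bj ℓ (j + 1) * Mp ℓ k M j i) = Nf ℓ k M := by
  funext i
  simp only [bj, Mp, Nf]
  rw [← mul_assoc, ← pow_add]
  congr 2
  omega

/-- the scale-`j` box has positive sides. [folklore] -/
theorem Mj_pos {ℓ k j : ℕ} {M : Fin (d + 1) → ℕ} (hM : ∀ i, 1 ≤ M i) (i : Fin (d + 1)) : 1 ≤ Mj ℓ k M j i := by
  simp only [Mj, Mp]
  exact Nat.one_le_iff_ne_zero.2 (Nat.mul_ne_zero (by omega)
    (Nat.mul_ne_zero (pow_ne_zero _ (by omega)) (by have := hM i; omega)))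

/-- the scale-`(j+1)` box has positive sides. [folklore] -/
theorem Mp_pos {ℓ k j : ℕ} {M : Fin (d + 1) → ℕ} (hM : ∀ i, 1 ≤ M i) (i : Fin (d + 1)) : 1 ≤ Mp ℓ k M j i := by
  simp only [Mp]
  exact Nat.one_le_iff_ne_zero.2 (Nat.mul_ne_zero (pow_ne_zero _ (by omega)) (by have := hM i; omega))

/-- the fine box has positive sides. [folklore] -/
theorem Nf_pos {ℓ k : ℕ} {M : Fin (d + 1) → ℕ} (hM : ∀ i, 1 ≤ M i) (i : Fin (d + 1)) : 1 ≤ Nf ℓ k M i := by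
  simp only [Nf]
  exact Nat.one_le_iff_ne_zero.2 (Nat.mul_ne_zero (pow_ne_zero _ (by omega)) (by have := hM i; omega))

/-- the cast `X_j := Π[0, b_j·(L·Mp_j)) ≃ X = Π[0, L^k·M)` (same set of lattice points). [folklore] -/
def ej (ℓ k : ℕ) (M : Fin (d + 1) → ℕ) (j : ℕ) (hj : j + 1 ≤ k) :
    ↥(boxDom (fun i => bj ℓ j * Mj ℓ k M j i)) ≃ ↥(boxDom (Nf ℓ k M)) :=
  boxCast (Nf_eq_bj_Mj hj M)

/-- the box operator of the scale-`j` fine box, read through the cast, is the same operator on the fine box. [folklore] -/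
theorem opBoxR_ej {ℓ k j : ℕ} (hj : j + 1 ≤ k) {M : Fin (d + 1) → ℕ} (c₁ msq a : ℝ) (b : ℕ)
    (x y : ↥(boxDom (Nf ℓ k M))) :
    opBoxR c₁ msq a b (fun i => bj ℓ j * Mj ℓ k M j i) ((ej ℓ k M j hj).symm x) ((ej ℓ k M j hj).symm y)
      = opBoxR c₁ msq a b (Nf ℓ k M) x y :=
  (opBoxR_boxCast (Nf_eq_bj_Mj hj M) c₁ msq a b x y).symm

/-- iterated block labels: `blk a (blk b x) = blk (b·a) x`. [folklore] -/
theorem blk_blk (a b : ℕ) (x : Fin (d + 1) → ℤ) : blk a (blk b x) = blk (b * a) x := by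
  funext i
  simp only [blk]
  push_cast
  exact Int.ediv_ediv_of_nonneg (Int.natCast_nonneg b)

/-- `blk L (blk (L^j) x) = blk (L^{j+1}) x`. [folklore] -/
theorem blk_L_blk_bj (ℓ j : ℕ) (x : Fin (d + 1) → ℤ) : blk (ℓ + 1) (blk (bj ℓ j) x) = blk (bj ℓ (j + 1)) x := by
  rw [blk_blk, bj, bj, pow_succ]

/-- the `b_j`-block label of a fine site lies in the scale-`j` box. [folklore] -/
theorem blk_bj_mem {ℓ k j : ℕ} (hj : j + 1 ≤ k) (M : Fin (d + 1) → ℕ) (x : ↥(boxDom (Nf ℓ k M))) :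
    blk (bj ℓ j) x.1 ∈ boxDom (Mj ℓ k M j) :=
  blk_mem_boxDom (bj_pos ℓ j) (mem_boxDom_of_eq (Nf_eq_bj_Mj hj M).symm x.2)

/-- the `b_{j+1}`-block label of a fine site lies in the scale-`(j+1)` box. [folklore] -/
theorem blk_bj_succ_mem {ℓ k j : ℕ} (hj : j + 1 ≤ k) (M : Fin (d + 1) → ℕ) (x : ↥(boxDom (Nf ℓ k M))) :
    blk (bj ℓ (j + 1)) x.1 ∈ boxDom (Mp ℓ k M j) :=
  blk_mem_boxDom (bj_pos ℓ (j + 1)) (mem_boxDom_of_eq (Nf_eq_bj_Mp hj M).symm x.2)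

/-- the `L`-block label of a scale-`j` unit site lies in the scale-`(j+1)` box. [folklore] -/
theorem blk_L_mem {ℓ k j : ℕ} (M : Fin (d + 1) → ℕ) (y : ↥(boxDom (Mj ℓ k M j))) :
    blk (ℓ + 1) y.1 ∈ boxDom (Mp ℓ k M j) :=
  blk_mem_boxDom (by omega) y.2

/-! ## §3 Block-averaging matrices `Q`, `Q^*` between boxes and the projection `P = Q^*Q` -/

/-- `Q` (block MEAN over `b`-blocks, counting measure): `Q(y, x) = b^{-(d+1)}·[blk b x = y]`.
[cite: Balaban1983RegularityDecay, p. 572 (1.4)–(1.5), dictionary] [folklore] -/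
def QkM (b : ℕ) (NU NF : Fin (d + 1) → ℕ) : Matrix ↥(boxDom NU) ↥(boxDom NF) ℝ :=
  Matrix.of fun y x => if blk b x.1 = y.1 then (((b : ℝ)) ^ (d + 1))⁻¹ else 0

/-- `Q^*` (piecewise-constant extension, the counting-measure adjoint of `Q`): `Q^*(x, y) = [blk b x = y]`. [folklore] -/
def QksM (b : ℕ) (NU NF : Fin (d + 1) → ℕ) : Matrix ↥(boxDom NF) ↥(boxDom NU) ℝ :=
  Matrix.of fun x y => if blk b x.1 = y.1 then 1 else 0

/-- the block projection `P_b = Q^*Q`: `P_b(x, x′) = b^{-(d+1)}·[blk b x′ = blk b x]`. [folklore] -/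
def Pmat (b : ℕ) (N : Fin (d + 1) → ℕ) : Matrix ↥(boxDom N) ↥(boxDom N) ℝ :=
  Matrix.of fun x x' => if blk b x'.1 = blk b x.1 then (((b : ℝ)) ^ (d + 1))⁻¹ else 0

/-- `Q^*Q = P` whenever every block label of the fine box lies in the unit box. [folklore] -/
theorem QksM_mul_QkM {b : ℕ} {NU NF : Fin (d + 1) → ℕ} (hmem : ∀ x : ↥(boxDom NF), blk b x.1 ∈ boxDom NU) :
    QksM b NU NF * QkM b NU NF = Pmat b NF := by
  ext x x'
  rw [Matrix.mul_apply]
  have key : ∀ y : ↥(boxDom NU), QksM b NU NF x y * QkM b NU NF y x'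
      = if y = ⟨blk b x.1, hmem x⟩ then (if blk b x'.1 = blk b x.1 then (((b : ℝ)) ^ (d + 1))⁻¹ else 0) else 0 := by
    intro y
    simp only [QksM, QkM, Matrix.of_apply]
    by_cases hy : y = ⟨blk b x.1, hmem x⟩
    · subst hy
      simp
    · have hy' : blk b x.1 ≠ y.1 := fun h => hy (Subtype.ext h.symm)
      simp [hy, hy']
  rw [Finset.sum_congr rfl fun y _ => key y, Finset.sum_ite_eq' Finset.univ, if_pos (Finset.mem_univ _)]
  rfl

/-- `QQ^* = 1` when the fine box is the unit box refined by `b`-blocks (every block has `b^{d+1}` sites). [folklore] -/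
theorem QkM_mul_QksM {b : ℕ} (hb : 1 ≤ b) (NU : Fin (d + 1) → ℕ) :
    QkM b NU (fun i => b * NU i) * QksM b NU (fun i => b * NU i) = 1 := by
  ext y y'
  rw [Matrix.mul_apply]
  have hb0 : ((b : ℝ)) ^ (d + 1) ≠ 0 := by positivity
  have key : ∀ x : ↥(boxDom (fun i => b * NU i)), QkM b NU _ y x * QksM b NU _ x y'
      = if blk b x.1 = y.1 then (if y = y' then (((b : ℝ)) ^ (d + 1))⁻¹ else 0) else 0 := by
    intro x
    simp only [QkM, QksM, Matrix.of_apply]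
    by_cases h1 : blk b x.1 = y.1
    · by_cases h2 : y = y'
      · subst h2; simp [h1]
      · have h2' : blk b x.1 ≠ y'.1 := fun h => h2 (Subtype.ext (h1.symm.trans h))
        simp [h2, h2']
    · simp [h1]
  rw [Finset.sum_congr rfl fun x _ => key x, ← Finset.sum_filter, Finset.sum_const, card_filter_blk hb NU y,
    nsmul_eq_mul, Matrix.one_apply]
  by_cases h2 : y = y'
  · rw [if_pos h2, if_pos h2]; push_cast; field_simp
  · rw [if_neg h2, if_neg h2, mul_zero]

/-- composition of extensions: `Q^*_{b} Q^*_{L} = Q^*_{bL}` (block labels iterate), given the memberships. [folklore] -/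
theorem QksM_mul_QksM {b c : ℕ} {NV NU NF : Fin (d + 1) → ℕ}
    (hmem : ∀ x : ↥(boxDom NF), blk b x.1 ∈ boxDom NU) :
    QksM b NU NF * QksM c NV NU = QksM (b * c) NV NF := by
  ext x y'
  rw [Matrix.mul_apply]
  have key : ∀ y : ↥(boxDom NU), QksM b NU NF x y * QksM c NV NU y y'
      = if y = ⟨blk b x.1, hmem x⟩ then (if blk c (blk b x.1) = y'.1 then (1 : ℝ) else 0) else 0 := by
    intro y
    simp only [QksM, Matrix.of_apply]
    by_cases hy : y = ⟨blk b x.1, hmem x⟩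
    · subst hy; simp
    · have hy' : blk b x.1 ≠ y.1 := fun h => hy (Subtype.ext h.symm)
      simp [hy, hy']
  rw [Finset.sum_congr rfl fun y _ => key y, Finset.sum_ite_eq' Finset.univ, if_pos (Finset.mem_univ _)]
  simp only [QksM, Matrix.of_apply, blk_blk]

/-- composition of means: `Q_{L} Q_{b} = Q_{bL}`, given the memberships. [folklore] -/
theorem QkM_mul_QkM {b c : ℕ} {NV NU NF : Fin (d + 1) → ℕ}
    (hmem : ∀ x : ↥(boxDom NF), blk b x.1 ∈ boxDom NU) :
    QkM c NV NU * QkM b NU NF = QkM (b * c) NV NF := by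
  ext y' x
  rw [Matrix.mul_apply]
  have key : ∀ y : ↥(boxDom NU), QkM c NV NU y' y * QkM b NU NF y x
      = if y = ⟨blk b x.1, hmem x⟩ then
          (if blk c (blk b x.1) = y'.1 then (((c : ℝ)) ^ (d + 1))⁻¹ * (((b : ℝ)) ^ (d + 1))⁻¹ else 0) else 0 := by
    intro y
    simp only [QkM, Matrix.of_apply]
    by_cases hy : y = ⟨blk b x.1, hmem x⟩
    · subst hy
      by_cases h2 : blk c (blk b x.1) = y'.1 <;> simp [h2]
    · have hy' : blk b x.1 ≠ y.1 := fun h => hy (Subtype.ext h.symm)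
      simp [hy, hy']
  rw [Finset.sum_congr rfl fun y _ => key y, Finset.sum_ite_eq' Finset.univ, if_pos (Finset.mem_univ _)]
  simp only [QkM, Matrix.of_apply, blk_blk]
  split_ifs
  · push_cast; rw [mul_pow, mul_inv, mul_comm]
  · rfl

/-! ## §4 The fine operators of all scales on the fine box and their identification with `boxOpR` -/

/-- `H = η^{-2}(−Δ^N_□) + m²` in VALUES form on the fine box (`η^{-2} = L^{2k}`; no averaging term). [folklore] -/
def Hfine (ℓ k : ℕ) (m2 : ℝ) (M : Fin (d + 1) → ℕ) :
    Matrix ↥(boxDom (Nf ℓ k M)) ↥(boxDom (Nf ℓ k M)) ℝ :=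
  opBoxR ((((ℓ + 1) ^ k : ℕ) : ℝ) ^ 2) m2 0 1 (Nf ℓ k M)

/-- the coefficient `α_j = a_j (L^jη)^{-2} = a_j·s_j²` of `P_j` in `G_j^η(□)^{-1}` (B1 (2.20), B4 (1.6) with `a ↤ a_j`).
[cite: Balaban1982Higgs1, (2.20) p.610] [folklore] -/
def αj (a : ℝ) (ℓ k j : ℕ) : ℝ := B1.aSeq a ((ℓ : ℝ) + 1) j * sc ℓ k j ^ 2

/-- `G_j^η(□)^{-1} = η^{-2}(−Δ^N_□) + m² + α_j P_j` in values form on the fine box. [folklore] -/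
def fineOp (ℓ k : ℕ) (M : Fin (d + 1) → ℕ) (j : ℕ) (a m2 : ℝ) :
    Matrix ↥(boxDom (Nf ℓ k M)) ↥(boxDom (Nf ℓ k M)) ℝ :=
  opBoxR ((((ℓ + 1) ^ k : ℕ) : ℝ) ^ 2) m2 (αj a ℓ k j * (((bj ℓ j : ℝ)) ^ (d + 1))⁻¹) (bj ℓ j) (Nf ℓ k M)

/-- entrywise linearity of `opBoxR` in its three coefficients. [folklore] -/
theorem smul_opBoxR_apply (s c₁ msq a : ℝ) (b : ℕ) (N : Fin (d + 1) → ℕ) (x y : ↥(boxDom N)) :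
    s * opBoxR c₁ msq a b N x y = opBoxR (s * c₁) (s * msq) (s * a) b N x y := by
  simp only [opBoxR, Matrix.of_apply, diagK, avgK]
  split_ifs <;> ring

/-- `H + α P_b` is the box operator with averaging coefficient `α/b^{d+1}` (entrywise bookkeeping). [folklore] -/
theorem Hfine_add_smul_Pmat (ℓ k : ℕ) (m2 α : ℝ) (M : Fin (d + 1) → ℕ) (b : ℕ) :
    Hfine ℓ k m2 M + α • Pmat b (Nf ℓ k M)
      = opBoxR ((((ℓ + 1) ^ k : ℕ) : ℝ) ^ 2) m2 (α * (((b : ℝ)) ^ (d + 1))⁻¹) b (Nf ℓ k M) := by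
  ext x y
  simp only [Hfine, Pmat, opBoxR, Matrix.add_apply, Matrix.smul_apply, Matrix.of_apply, diagK, avgK, smul_eq_mul]
  have h1 : (if blk 1 y.1 = blk 1 x.1 then (0 : ℝ) else 0) = 0 := by split_ifs <;> rfl
  rw [h1]
  split_ifs <;> ring

/-- hence `H + α_j P_{b_j} = fineOp_j`. [folklore] -/
theorem Hfine_add_fineP (ℓ k : ℕ) (M : Fin (d + 1) → ℕ) (j : ℕ) (a m2 : ℝ) :
    Hfine ℓ k m2 M + αj a ℓ k j • Pmat (bj ℓ j) (Nf ℓ k M) = fineOp ℓ k M j a m2 :=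
  Hfine_add_smul_Pmat ℓ k m2 _ M _

/-- the top scale: `fineOp_k = boxOpR(L^k, a_k, m², M)` — B4's `−Δ^η_□ + m² + aQ_k^*Q_k` in values form with `a ↤ a_k`,
`η = L^{-k}`. [cite: Balaban1983RegularityDecay, p. 572 (1.6), p. 584 (2.44), dictionary] [folklore] -/
theorem fineOp_top (ℓ k : ℕ) (M : Fin (d + 1) → ℕ) (a m2 : ℝ) :
    fineOp ℓ k M k a m2 = boxOpR ((ℓ + 1) ^ k) (B1.aSeq a ((ℓ : ℝ) + 1) k) m2 M := by
  simp only [fineOp, boxOpR, αj, sc_self, one_pow, mul_one, bj]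

/-- **IDENTIFICATION OF THE SCALE-`j` OPERATOR**: `fineOp_j = s_j² · boxOpR(b_j, a_j, m²/s_j², L·Mp_j)` transported to
the fine box (`s_j = L^{k-j}`): the operator `(L^jη)^{-2}·[b_j²(−Δ^N) + m²(L^jη)² + (a_j/b_j^{d+1})1_{same b_j-block}]`
of B4 (2.44) at scale `j`. [cite: Balaban1983RegularityDecay, p. 584 (2.44), dictionary] [folklore] -/
theorem fineOp_apply_eq {ℓ k j : ℕ} (hj : j + 1 ≤ k) (M : Fin (d + 1) → ℕ) (a m2 : ℝ)
    (x y : ↥(boxDom (Nf ℓ k M))) :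
    fineOp ℓ k M j a m2 x y
      = sc ℓ k j ^ 2 * boxOpR (bj ℓ j) (B1.aSeq a ((ℓ : ℝ) + 1) j) (m2 / sc ℓ k j ^ 2) (Mj ℓ k M j)
          ((ej ℓ k M j hj).symm x) ((ej ℓ k M j hj).symm y) := by
  rw [fineOp, boxOpR, opBoxR_ej hj, smul_opBoxR_apply]
  have hs : sc ℓ k j ^ 2 ≠ 0 := (pow_pos (sc_pos ℓ k j) 2).ne'
  have hn : ((((ℓ + 1) ^ k : ℕ) : ℝ)) ^ 2 = sc ℓ k j ^ 2 * ((bj ℓ j : ℝ)) ^ 2 := by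
    rw [← mul_pow, sc_mul_bj (by omega)]
    push_cast
    ring
  have hs0 : sc ℓ k j ≠ 0 := (sc_pos ℓ k j).ne'
  have hm : sc ℓ k j ^ 2 * (m2 / sc ℓ k j ^ 2) = m2 := by field_simp
  have hα : sc ℓ k j ^ 2 * (B1.aSeq a ((ℓ : ℝ) + 1) j * (((bj ℓ j : ℝ)) ^ (d + 1))⁻¹)
      = αj a ℓ k j * (((bj ℓ j : ℝ)) ^ (d + 1))⁻¹ := by
    simp only [αj]; ring
  rw [hm, hα, ← hn]

/-- matrix form of the identification: `fineOp_j = s_j² • (boxOpR_j reindexed)`. [folklore] -/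
theorem fineOp_eq_submatrix {ℓ k j : ℕ} (hj : j + 1 ≤ k) (M : Fin (d + 1) → ℕ) (a m2 : ℝ) :
    fineOp ℓ k M j a m2
      = sc ℓ k j ^ 2 • (boxOpR (bj ℓ j) (B1.aSeq a ((ℓ : ℝ) + 1) j) (m2 / sc ℓ k j ^ 2) (Mj ℓ k M j)).submatrix
          (ej ℓ k M j hj).symm (ej ℓ k M j hj).symm := by
  ext x y
  rw [fineOp_apply_eq hj, Matrix.smul_apply, Matrix.submatrix_apply, smul_eq_mul]

/-- `a_j` lies in the window `[a(1 − L^{-2}), a] ⊆ [a₋(1 − L^{-2}), a₊]`. [cite: Balaban1982Higgs1, (2.15) p.609] -/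
theorem aSeq_window {ℓ : ℕ} (hℓ : 1 ≤ ℓ) {a aminus aplus : ℝ} (ha : 0 < aminus) (h1 : aminus ≤ a) (h2 : a ≤ aplus)
    {j : ℕ} (hj : 1 ≤ j) :
    aminus * (1 - ((((ℓ : ℝ) + 1)) ^ 2)⁻¹) ≤ B1.aSeq a ((ℓ : ℝ) + 1) j ∧ B1.aSeq a ((ℓ : ℝ) + 1) j ≤ aplus ∧
      0 < B1.aSeq a ((ℓ : ℝ) + 1) j := by
  have hL := one_lt_L_real hℓ
  have ha' : 0 < a := lt_of_lt_of_le ha h1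
  have hq : 0 ≤ 1 - ((((ℓ : ℝ) + 1)) ^ 2)⁻¹ := by
    rw [sub_nonneg]
    apply inv_le_one_of_one_le₀
    nlinarith
  refine ⟨?_, (B1.aSeq_le ha' hL j hj).trans h2, B1.aSeq_pos ha' hL hj⟩
  calc aminus * (1 - ((((ℓ : ℝ) + 1)) ^ 2)⁻¹) ≤ a * (1 - ((((ℓ : ℝ) + 1)) ^ 2)⁻¹) :=
        mul_le_mul_of_nonneg_right h1 hq
    _ ≤ B1.aSeq a ((ℓ : ℝ) + 1) j := (B1.ainf_lt_aSeq ha' hL j hj).le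

/-- the lower end of the `a_j`-window is positive. [folklore] -/
theorem aminus'_pos {ℓ : ℕ} (hℓ : 1 ≤ ℓ) {aminus : ℝ} (ha : 0 < aminus) :
    0 < aminus * (1 - ((((ℓ : ℝ) + 1)) ^ 2)⁻¹) := by
  have hL := one_lt_L_real hℓ
  apply mul_pos ha
  rw [sub_pos]
  apply inv_lt_one_of_one_lt₀
  nlinarith

/-- the Green operator of scale `j` on the fine box: `G_j := fineOp_j⁻¹` = `G_j^η(□)` of B4 (2.34) in values form.
[cite: Balaban1983RegularityDecay, p. 582 (2.34), dictionary] [folklore] -/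
def Gfine (ℓ k : ℕ) (M : Fin (d + 1) → ℕ) (j : ℕ) (a m2 : ℝ) :
    Matrix ↥(boxDom (Nf ℓ k M)) ↥(boxDom (Nf ℓ k M)) ℝ :=
  (fineOp ℓ k M j a m2)⁻¹

/-- a scaled reindexed inverse is the inverse of the scaled reindexed matrix. [folklore] -/
theorem inv_smul_submatrix {m n : Type*} [Fintype m] [Fintype n] [DecidableEq m] [DecidableEq n]
    {A B : Matrix n n ℝ} (h : A * B = 1) {s : ℝ} (hs : s ≠ 0) (e : m ≃ n) :
    (s • A.submatrix e e)⁻¹ = s⁻¹ • B.submatrix e e := by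
  apply Matrix.inv_eq_right_inv
  rw [Matrix.smul_mul, Matrix.mul_smul, smul_smul, Matrix.submatrix_mul_equiv, h, Matrix.submatrix_one_equiv,
    mul_inv_cancel₀ hs, one_smul]

/-- **`G_j = s_j^{-2} · G_j(□)` reindexed**, `G_j(□) = boxOpR(b_j, a_j, m²s_j^{-2}, L·Mp_j)⁻¹` the lattice-unit Green function
of `B4Green242Bridge`/`B4BoxCov237` (so (2.35) applies to it). [folklore] -/
theorem Gfine_eq_submatrix {ℓ k j : ℕ} (hℓ : 1 ≤ ℓ) (hj1 : 1 ≤ j) (hj : j + 1 ≤ k) {M : Fin (d + 1) → ℕ}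
    (hM : ∀ i, 1 ≤ M i) {a m2 : ℝ} (ha : 0 < a) (hm : 0 ≤ m2) :
    Gfine ℓ k M j a m2
      = (sc ℓ k j ^ 2)⁻¹ • ((boxOpR (bj ℓ j) (B1.aSeq a ((ℓ : ℝ) + 1) j) (m2 / sc ℓ k j ^ 2)
          (Mj ℓ k M j))⁻¹).submatrix (ej ℓ k M j hj).symm (ej ℓ k M j hj).symm := by
  rw [Gfine, fineOp_eq_submatrix hj]
  exact inv_smul_submatrix (boxOpR_mul_inv (bj_pos ℓ j) (B1.aSeq_pos ha (one_lt_L_real hℓ) hj1)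
    (div_nonneg hm (sq_nonneg _)) (Mj_pos hM)) (pow_pos (sc_pos ℓ k j) 2).ne' _

/-- entries of `G_j`. [folklore] -/
theorem Gfine_apply {ℓ k j : ℕ} (hℓ : 1 ≤ ℓ) (hj1 : 1 ≤ j) (hj : j + 1 ≤ k) {M : Fin (d + 1) → ℕ}
    (hM : ∀ i, 1 ≤ M i) {a m2 : ℝ} (ha : 0 < a) (hm : 0 ≤ m2) (x y : ↥(boxDom (Nf ℓ k M))) :
    Gfine ℓ k M j a m2 x y
      = (sc ℓ k j ^ 2)⁻¹ * (boxOpR (bj ℓ j) (B1.aSeq a ((ℓ : ℝ) + 1) j) (m2 / sc ℓ k j ^ 2) (Mj ℓ k M j))⁻¹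
          ((ej ℓ k M j hj).symm x) ((ej ℓ k M j hj).symm y) := by
  rw [Gfine_eq_submatrix hℓ hj1 hj hM ha hm, Matrix.smul_apply, Matrix.submatrix_apply, smul_eq_mul]

/-- `fineOp_j · G_j = 1` on the window (genuine inverse). [folklore] -/
theorem fineOp_mul_Gfine {ℓ k j : ℕ} (hℓ : 1 ≤ ℓ) (hj1 : 1 ≤ j) (hj : j + 1 ≤ k) {M : Fin (d + 1) → ℕ}
    (hM : ∀ i, 1 ≤ M i) {a m2 : ℝ} (ha : 0 < a) (hm : 0 ≤ m2) :
    fineOp ℓ k M j a m2 * Gfine ℓ k M j a m2 = 1 := by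
  rw [Gfine_eq_submatrix hℓ hj1 hj hM ha hm, fineOp_eq_submatrix hj, Matrix.smul_mul, Matrix.mul_smul, smul_smul,
    Matrix.submatrix_mul_equiv, boxOpR_mul_inv (bj_pos ℓ j) (B1.aSeq_pos ha (one_lt_L_real hℓ) hj1)
    (div_nonneg hm (sq_nonneg _)) (Mj_pos hM), Matrix.submatrix_one_equiv,
    mul_inv_cancel₀ (pow_pos (sc_pos ℓ k j) 2).ne', one_smul]

/-- `fineOp_j` is a unit on the window. [folklore] -/
theorem fineOp_isUnit {ℓ k j : ℕ} (hℓ : 1 ≤ ℓ) (hj1 : 1 ≤ j) (hj : j + 1 ≤ k) {M : Fin (d + 1) → ℕ}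
    (hM : ∀ i, 1 ≤ M i) {a m2 : ℝ} (ha : 0 < a) (hm : 0 ≤ m2) : IsUnit (fineOp ℓ k M j a m2) :=
  (Matrix.isUnit_iff_isUnit_det _).mpr (Matrix.isUnit_det_of_right_inverse (fineOp_mul_Gfine hℓ hj1 hj hM ha hm))

/-- `G_j` is symmetric. [folklore] -/
theorem Gfine_isSymm (ℓ k : ℕ) (M : Fin (d + 1) → ℕ) (j : ℕ) (a m2 : ℝ) : (Gfine ℓ k M j a m2).IsSymm := by
  unfold Gfine fineOp Matrix.IsSymm
  rw [Matrix.transpose_nonsing_inv, (opBoxR_isSymm _ _ _ _ _).eq]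

/-- a sum over the fine box is the same sum over the reindexed scale-`j` fine box. [folklore] -/
theorem sum_Nf_eq_sum_ej {ℓ k j : ℕ} (hj : j + 1 ≤ k) (M : Fin (d + 1) → ℕ) (f : ↥(boxDom (Nf ℓ k M)) → ℝ) :
    ∑ x : ↥(boxDom (Nf ℓ k M)), f x = ∑ z : ↥(boxDom (fun i => bj ℓ j * Mj ℓ k M j i)), f (ej ℓ k M j hj z) :=
  (Equiv.sum_comp (ej ℓ k M j hj) f).symm

/-- **BLOCK-ROW SUMS OF `G_j` DECAY** (transport of (2.35) to the fine box, with the factor `s_j^{-2} = (L^jη)²`):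
`|Σ_{x′ : blk_{b_j} x′ = y} G_j(x, x′)| ≤ s_j^{-2} C e^{−κ|blk_{b_j} x − y|}`. [cite: Balaban1983RegularityDecay, p. 582 (2.35)] -/
theorem Gfine_blockRow_bound (d ℓ : ℕ) (hℓ : 1 ≤ ℓ) (aminus aplus m2plus : ℝ) (ha : 0 < aminus) :
    ∃ κ C : ℝ, 0 < κ ∧ 0 ≤ C ∧ ∀ (k j : ℕ), 1 ≤ j → ∀ (hj : j + 1 ≤ k), ∀ (a m2 : ℝ), aminus ≤ a → a ≤ aplus →
      0 ≤ m2 → m2 ≤ m2plus → ∀ (M : Fin (d + 1) → ℕ), (∀ i, 1 ≤ M i) →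
        ∀ (x : ↥(boxDom (Nf ℓ k M))) (y : Fin (d + 1) → ℤ), y ∈ boxDom (Mj ℓ k M j) →
          |∑ x' : ↥(boxDom (Nf ℓ k M)), (if blk (bj ℓ j) x'.1 = y then Gfine ℓ k M j a m2 x x' else 0)|
            ≤ (sc ℓ k j ^ 2)⁻¹ * C * Real.exp (-(κ * supNorm (blk (bj ℓ j) x.1 - y))) := by
  obtain ⟨κ, C, hκ, hC, h⟩ := B4TwoBox120.green_blockRow_bound d (aminus * (1 - ((((ℓ : ℝ) + 1)) ^ 2)⁻¹)) aplus m2plus (aminus'_pos hℓ ha)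
  refine ⟨κ, C, hκ, hC, fun k j hj1 hj a m2 h1 h2 h3 h4 M hM x y hy => ?_⟩
  have ha0 : 0 < a := lt_of_lt_of_le ha h1
  obtain ⟨hw1, hw2, hapos⟩ := aSeq_window hℓ ha h1 h2 hj1
  have hs : 0 < sc ℓ k j ^ 2 := pow_pos (sc_pos ℓ k j) 2
  have hm' : 0 ≤ m2 / sc ℓ k j ^ 2 := div_nonneg h3 hs.le
  have hm'' : m2 / sc ℓ k j ^ 2 ≤ m2plus := by
    calc m2 / sc ℓ k j ^ 2 ≤ m2 / 1 := by
          apply div_le_div_of_nonneg_left h3 one_pos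
          exact one_le_pow₀ (one_le_sc ℓ k j)
      _ ≤ m2plus := by rw [div_one]; exact h4
  have hrow := h (bj ℓ j) (bj_pos ℓ j) _ _ hw1 hw2 hm' hm'' (Mj ℓ k M j) (Mj_pos hM) ((ej ℓ k M j hj).symm x) y hy
  have hxv : ((ej ℓ k M j hj).symm x).1 = x.1 := rfl
  rw [hxv] at hrow
  have hsum : ∑ x' : ↥(boxDom (Nf ℓ k M)), (if blk (bj ℓ j) x'.1 = y then Gfine ℓ k M j a m2 x x' else 0)
      = (sc ℓ k j ^ 2)⁻¹ * ∑ z : ↥(boxDom (fun i => bj ℓ j * Mj ℓ k M j i)),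
          (if blk (bj ℓ j) z.1 = y then
            (boxOpR (bj ℓ j) (B1.aSeq a ((ℓ : ℝ) + 1) j) (m2 / sc ℓ k j ^ 2) (Mj ℓ k M j))⁻¹
              ((ej ℓ k M j hj).symm x) z else 0) := by
    rw [sum_Nf_eq_sum_ej hj, Finset.mul_sum]
    refine Finset.sum_congr rfl fun z _ => ?_
    have hzv : (ej ℓ k M j hj z).1 = z.1 := rfl
    rw [hzv]
    split_ifs with hz
    · rw [Gfine_apply hℓ hj1 hj hM ha0 h3, Equiv.symm_apply_apply]
    · rw [mul_zero]
  rw [hsum, abs_mul, abs_of_pos (inv_pos.2 hs), mul_assoc]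
  exact mul_le_mul_of_nonneg_left hrow (inv_pos.2 hs).le

/-! ## §5 The step data of scale `j` (B1RG242.StepData on the box) and the identification of its objects -/

/-- B1's step data at scale `j` on the box `□` at `A = 0`, values form: `H = η^{-2}(−Δ^N_□) + m²`; `Q_j, Q_j^*` the
`b_j`-block mean/extension between the fine box and `□^{(j)}`; `Q, Q^*` the `L`-block mean/extension between `□^{(j)}`
and `□^{(j+1)}`; `α = a_j(L^jη)^{-2}`, `β = a(L^{j+1}η)^{-2}`.
[cite: Balaban1982Higgs1, (2.7) p.608, (2.11) p.609, (2.20) p.610, (2.30) p.611]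
[cite: Balaban1983RegularityDecay, p. 582 (2.34), dictionary] [folklore] -/
def stepD (ℓ k : ℕ) (M : Fin (d + 1) → ℕ) (j : ℕ) (a m2 : ℝ) :
    B1RG242.StepData ℝ ↥(boxDom (Nf ℓ k M)) ↥(boxDom (Mj ℓ k M j)) ↥(boxDom (Mp ℓ k M j)) where
  H := Hfine ℓ k m2 M
  Qk := QkM (bj ℓ j) (Mj ℓ k M j) (Nf ℓ k M)
  Qks := QksM (bj ℓ j) (Mj ℓ k M j) (Nf ℓ k M)
  Q := QkM (ℓ + 1) (Mp ℓ k M j) (Mj ℓ k M j)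
  Qs := QksM (ℓ + 1) (Mp ℓ k M j) (Mj ℓ k M j)
  α := αj a ℓ k j
  β := a * sc ℓ k (j + 1) ^ 2

section Step

variable {ℓ k j : ℕ} {M : Fin (d + 1) → ℕ} {a m2 : ℝ}

/-- `QQ^* = 1` on `□^{(j)} → □^{(j+1)}` (every `L`-block has `L^{d+1}` sites). [folklore] -/
theorem stepD_QQs (ℓ k : ℕ) (M : Fin (d + 1) → ℕ) (j : ℕ) (a m2 : ℝ) :
    (stepD ℓ k M j a m2).Q * (stepD ℓ k M j a m2).Qs = 1 :=
  QkM_mul_QksM (by omega) (Mp ℓ k M j)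

/-- `P_j = Q_j^*Q_j` is the `b_j`-block projection on the fine box. [folklore] -/
theorem stepD_Pk (hj : j + 1 ≤ k) :
    (stepD ℓ k M j a m2).Pk = Pmat (bj ℓ j) (Nf ℓ k M) :=
  QksM_mul_QkM (blk_bj_mem hj M)

/-- the argument of `G_j`: `H + αP_j = fineOp_j`. [folklore] -/
theorem stepD_G_arg (hj : j + 1 ≤ k) :
    (stepD ℓ k M j a m2).H + (stepD ℓ k M j a m2).α • (stepD ℓ k M j a m2).Pk = fineOp ℓ k M j a m2 := by
  rw [stepD_Pk hj]
  exact Hfine_add_fineP ℓ k M j a m2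

/-- `G^ε_j` of the step data is `G_j`. [folklore] -/
theorem stepD_Gk (hj : j + 1 ≤ k) : (stepD ℓ k M j a m2).Gk = Gfine ℓ k M j a m2 := by
  rw [B1RG242.StepData.Gk, stepD_G_arg hj, Gfine]

/-- `P = Q^*Q` on `□^{(j)}` is the `L`-block projection `blockAvgP`. [folklore] -/
theorem stepD_P (ℓ k : ℕ) (M : Fin (d + 1) → ℕ) (j : ℕ) (a m2 : ℝ) :
    (stepD ℓ k M j a m2).P = blockAvgP ℓ (Mp ℓ k M j) := by
  have h : (stepD ℓ k M j a m2).P = Pmat (ℓ + 1) (Mj ℓ k M j) := QksM_mul_QkM (blk_L_mem M)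
  rw [h]
  ext y y'
  simp only [Pmat, blockAvgP, Matrix.of_apply]
  push_cast
  by_cases hc : blk (ℓ + 1) y.1 = blk (ℓ + 1) y'.1
  · rw [if_pos hc, if_pos hc.symm]
  · rw [if_neg hc, if_neg (fun h' => hc h'.symm)]

/-- the filtered double block sum of `G_j` is `s_j^{-2}` times that of `G_j(□)` (reindexing). [folklore] -/
theorem blockSum2_Gfine (hℓ : 1 ≤ ℓ) (hj1 : 1 ≤ j) (hj : j + 1 ≤ k) (hM : ∀ i, 1 ≤ M i) (ha : 0 < a) (hm : 0 ≤ m2)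
    (y y' : ↥(boxDom (Mj ℓ k M j))) :
    ∑ x : ↥(boxDom (Nf ℓ k M)), ∑ x' : ↥(boxDom (Nf ℓ k M)),
        (if blk (bj ℓ j) x.1 = y.1 then (1 : ℝ) else 0) * Gfine ℓ k M j a m2 x x' *
          (if blk (bj ℓ j) x'.1 = y'.1 then (1 : ℝ) else 0)
      = (sc ℓ k j ^ 2)⁻¹ *
        (indB (bj ℓ j) (Mj ℓ k M j) *
            (boxOpR (bj ℓ j) (B1.aSeq a ((ℓ : ℝ) + 1) j) (m2 / sc ℓ k j ^ 2) (Mj ℓ k M j))⁻¹ *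
          (indB (bj ℓ j) (Mj ℓ k M j))ᵀ) y y' := by
  rw [indB_mul_mul_transpose_apply, Finset.mul_sum, sum_Nf_eq_sum_ej hj, Finset.sum_filter]
  refine Finset.sum_congr rfl fun z _ => ?_
  have hzv : (ej ℓ k M j hj z).1 = z.1 := rfl
  rw [hzv]
  split_ifs with hz
  · rw [Finset.mul_sum, sum_Nf_eq_sum_ej hj, Finset.sum_filter]
    refine Finset.sum_congr rfl fun z' _ => ?_
    have hzv' : (ej ℓ k M j hj z').1 = z'.1 := rfl
    rw [hzv']
    split_ifs with hz'
    · rw [Gfine_apply hℓ hj1 hj hM ha hm, Equiv.symm_apply_apply, Equiv.symm_apply_apply]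
      ring
    · ring
  · symm
    rw [Finset.sum_eq_zero]
    intro x' _
    ring

/-- `Q_jG_jQ_j^* = b_j^{-(d+1)} s_j^{-2}·(indB·G_j(□)·indBᵀ)`. [folklore] -/
theorem stepD_QGQ (hℓ : 1 ≤ ℓ) (hj1 : 1 ≤ j) (hj : j + 1 ≤ k) (hM : ∀ i, 1 ≤ M i) (ha : 0 < a) (hm : 0 ≤ m2) :
    (stepD ℓ k M j a m2).Qk * (stepD ℓ k M j a m2).Gk * (stepD ℓ k M j a m2).Qks
      = ((((bj ℓ j : ℝ)) ^ (d + 1))⁻¹ * (sc ℓ k j ^ 2)⁻¹) •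
        (indB (bj ℓ j) (Mj ℓ k M j) *
            (boxOpR (bj ℓ j) (B1.aSeq a ((ℓ : ℝ) + 1) j) (m2 / sc ℓ k j ^ 2) (Mj ℓ k M j))⁻¹ *
          (indB (bj ℓ j) (Mj ℓ k M j))ᵀ) := by
  rw [stepD_Gk hj]
  ext y y'
  rw [Matrix.smul_apply, smul_eq_mul, mul_assoc, ← blockSum2_Gfine hℓ hj1 hj hM ha hm y y', Matrix.mul_apply,
    Finset.mul_sum]
  simp_rw [Matrix.mul_apply, Finset.sum_mul]
  rw [Finset.sum_comm]
  refine Finset.sum_congr rfl fun x _ => ?_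
  rw [Finset.mul_sum]
  refine Finset.sum_congr rfl fun x' _ => ?_
  simp only [stepD, QkM, QksM, Matrix.of_apply]
  split_ifs <;> ring

/-- **`Δ^{(j)}` of the step data is `s_j² · Δ^{(j)}(□)` = `s_j² · Keff`** (B4 (1.14) at `A = 0`, lattice units, times
`(L^jη)^{-2}`). [cite: Balaban1983RegularityDecay, p. 573 (1.14), dictionary] [folklore] -/
theorem stepD_Δk (hℓ : 1 ≤ ℓ) (hj1 : 1 ≤ j) (hj : j + 1 ≤ k) (hM : ∀ i, 1 ≤ M i) (ha : 0 < a) (hm : 0 ≤ m2) :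
    (stepD ℓ k M j a m2).Δk
      = sc ℓ k j ^ 2 • Keff (bj ℓ j) (B1.aSeq a ((ℓ : ℝ) + 1) j) (m2 / sc ℓ k j ^ 2) (Mj ℓ k M j) := by
  rw [B1RG242.StepData.Δk, stepD_QGQ hℓ hj1 hj hM ha hm, Keff]
  ext y y'
  simp only [Matrix.sub_apply, Matrix.smul_apply, smul_eq_mul, stepD, αj]
  have hs : sc ℓ k j ^ 2 ≠ 0 := (pow_pos (sc_pos ℓ k j) 2).ne'
  have hb : ((bj ℓ j : ℝ)) ^ (d + 1) ≠ 0 := by positivity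
  field_simp

/-- **`βP + Δ^{(j)}` of the step data is `s_j² · C^{(j)}(□)^{-1}` = `s_j² · covOp`** (B4 (1.13) at `A = 0`).
[cite: Balaban1983RegularityDecay, p. 573 (1.13)–(1.14), dictionary] [folklore] -/
theorem stepD_C_arg (hℓ : 1 ≤ ℓ) (hj1 : 1 ≤ j) (hj : j + 1 ≤ k) (hM : ∀ i, 1 ≤ M i) (ha : 0 < a) (hm : 0 ≤ m2) :
    (stepD ℓ k M j a m2).β • (stepD ℓ k M j a m2).P + (stepD ℓ k M j a m2).Δk
      = sc ℓ k j ^ 2 • covOp (bj ℓ j) ℓ (B1.aSeq a ((ℓ : ℝ) + 1) j) a (m2 / sc ℓ k j ^ 2) (Mp ℓ k M j) := by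
  rw [stepD_Δk hℓ hj1 hj hM ha hm, stepD_P, covOp]
  ext y y'
  simp only [Matrix.add_apply, Matrix.smul_apply, smul_eq_mul, stepD]
  rw [sc_eq_succ hj]
  have hL : ((ℓ : ℝ) + 1) ≠ 0 := (L_real_pos ℓ).ne'
  field_simp
  ring

/-- the scaled inverse covariance is a genuine right inverse. [folklore] -/
theorem stepD_C_arg_mul (hℓ : 1 ≤ ℓ) (hj1 : 1 ≤ j) (hj : j + 1 ≤ k) (hM : ∀ i, 1 ≤ M i) (ha : 0 < a) (hm : 0 ≤ m2) :
    ((stepD ℓ k M j a m2).β • (stepD ℓ k M j a m2).P + (stepD ℓ k M j a m2).Δk) *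
        ((sc ℓ k j ^ 2)⁻¹ • (covOp (bj ℓ j) ℓ (B1.aSeq a ((ℓ : ℝ) + 1) j) a (m2 / sc ℓ k j ^ 2) (Mp ℓ k M j))⁻¹)
      = 1 := by
  rw [stepD_C_arg hℓ hj1 hj hM ha hm, Matrix.smul_mul, Matrix.mul_smul, smul_smul,
    covOp_mul_inv (bj_pos ℓ j) hℓ (B1.aSeq_pos ha (one_lt_L_real hℓ) hj1) ha (div_nonneg hm (sq_nonneg _))
      (Mp_pos hM), mul_inv_cancel₀ (pow_pos (sc_pos ℓ k j) 2).ne', one_smul]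

/-- `βP + Δ^{(j)}` is a unit on the window. [folklore] -/
theorem stepD_C_isUnit (hℓ : 1 ≤ ℓ) (hj1 : 1 ≤ j) (hj : j + 1 ≤ k) (hM : ∀ i, 1 ≤ M i) (ha : 0 < a) (hm : 0 ≤ m2) :
    IsUnit ((stepD ℓ k M j a m2).β • (stepD ℓ k M j a m2).P + (stepD ℓ k M j a m2).Δk) :=
  (Matrix.isUnit_iff_isUnit_det _).mpr (Matrix.isUnit_det_of_right_inverse (stepD_C_arg_mul hℓ hj1 hj hM ha hm))

/-- **`C^{(j)}` of the step data is `s_j^{-2} · C^{(j)}(□)` = `s_j^{-2} · covOp⁻¹`** ((2.37) applies to it).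
[cite: Balaban1983RegularityDecay, p. 582 (2.37)] [folklore] -/
theorem stepD_Ck (hℓ : 1 ≤ ℓ) (hj1 : 1 ≤ j) (hj : j + 1 ≤ k) (hM : ∀ i, 1 ≤ M i) (ha : 0 < a) (hm : 0 ≤ m2) :
    (stepD ℓ k M j a m2).Ck
      = (sc ℓ k j ^ 2)⁻¹ • (covOp (bj ℓ j) ℓ (B1.aSeq a ((ℓ : ℝ) + 1) j) a (m2 / sc ℓ k j ^ 2) (Mp ℓ k M j))⁻¹ :=
  Matrix.inv_eq_right_inv (stepD_C_arg_mul hℓ hj1 hj hM ha hm)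

/-- the argument of `G_j` is a unit on the window. [folklore] -/
theorem stepD_G_isUnit (hℓ : 1 ≤ ℓ) (hj1 : 1 ≤ j) (hj : j + 1 ≤ k) (hM : ∀ i, 1 ≤ M i) (ha : 0 < a) (hm : 0 ≤ m2) :
    IsUnit ((stepD ℓ k M j a m2).H + (stepD ℓ k M j a m2).α • (stepD ℓ k M j a m2).Pk) := by
  rw [stepD_G_arg hj]
  exact fineOp_isUnit hℓ hj1 hj hM ha hm

/-- `α + β ≠ 0` (both positive). [folklore] -/
theorem stepD_αβ (hℓ : 1 ≤ ℓ) (hj1 : 1 ≤ j) (ha : 0 < a) :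
    (stepD ℓ k M j a m2).α + (stepD ℓ k M j a m2).β ≠ 0 := by
  have h1 : 0 < B1.aSeq a ((ℓ : ℝ) + 1) j := B1.aSeq_pos ha (one_lt_L_real hℓ) hj1
  have h2 := sc_pos ℓ k j
  have h3 := sc_pos ℓ k (j + 1)
  simp only [stepD, αj]
  positivity

/-- **B1 (2.13) in this bookkeeping: `γ = αβ/(α+β) = α_{j+1}`**. [cite: Balaban1982Higgs1, (2.13) p.609] -/
theorem stepD_γ (hℓ : 1 ≤ ℓ) (hj1 : 1 ≤ j) (hj : j + 1 ≤ k) (ha : 0 < a) :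
    (stepD ℓ k M j a m2).γ = αj a ℓ k (j + 1) := by
  have hL := one_lt_L_real hℓ
  have h1 : 0 < B1.aSeq a ((ℓ : ℝ) + 1) j := B1.aSeq_pos ha hL hj1
  have h3 := sc_pos ℓ k (j + 1)
  have hL0 : ((ℓ : ℝ) + 1) ≠ 0 := (L_real_pos ℓ).ne'
  simp only [B1RG242.StepData.γ, stepD, αj]
  rw [B1.aSeq_succ ha hL hj1, sc_eq_succ hj]
  have hden : a * ((((ℓ : ℝ) + 1)) ^ 2)⁻¹ + B1.aSeq a ((ℓ : ℝ) + 1) j ≠ 0 := by positivity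
  have hden2 : B1.aSeq a ((ℓ : ℝ) + 1) j * ((((ℓ : ℝ) + 1)) * sc ℓ k (j + 1)) ^ 2 + a * sc ℓ k (j + 1) ^ 2 ≠ 0 := by
    positivity
  field_simp
  ring

/-- `Q^*_jQ^* = Q^*_{j+1}` (iterated block labels). [folklore] -/
theorem stepD_Qk1s (hj : j + 1 ≤ k) :
    (stepD ℓ k M j a m2).Qk1s = QksM (bj ℓ (j + 1)) (Mp ℓ k M j) (Nf ℓ k M) := by
  rw [B1RG242.StepData.Qk1s]
  show QksM (bj ℓ j) (Mj ℓ k M j) (Nf ℓ k M) * QksM (ℓ + 1) (Mp ℓ k M j) (Mj ℓ k M j) = _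
  rw [QksM_mul_QksM (blk_bj_mem hj M), bj, bj, pow_succ]

/-- `QQ_j = Q_{j+1}`. [folklore] -/
theorem stepD_Qk1 (hj : j + 1 ≤ k) :
    (stepD ℓ k M j a m2).Qk1 = QkM (bj ℓ (j + 1)) (Mp ℓ k M j) (Nf ℓ k M) := by
  rw [B1RG242.StepData.Qk1]
  show QkM (ℓ + 1) (Mp ℓ k M j) (Mj ℓ k M j) * QkM (bj ℓ j) (Mj ℓ k M j) (Nf ℓ k M) = _
  rw [QkM_mul_QkM (blk_bj_mem hj M), bj, bj, pow_succ]

/-- `P_{j+1} = Q^*_{j+1}Q_{j+1}` is the `b_{j+1}`-block projection on the fine box. [folklore] -/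
theorem stepD_Pk1 (hj : j + 1 ≤ k) :
    (stepD ℓ k M j a m2).Pk1 = Pmat (bj ℓ (j + 1)) (Nf ℓ k M) := by
  rw [B1RG242.StepData.Pk1, stepD_Qk1s hj, stepD_Qk1 hj]
  exact QksM_mul_QkM (blk_bj_succ_mem hj M)

/-- **`G^ε_{j+1}` of the step data is `G_{j+1}`** (the argument `H + γP_{j+1}` is `fineOp_{j+1}`). [folklore] -/
theorem stepD_Gk1 (hℓ : 1 ≤ ℓ) (hj1 : 1 ≤ j) (hj : j + 1 ≤ k) (ha : 0 < a) :
    (stepD ℓ k M j a m2).Gk1 = Gfine ℓ k M (j + 1) a m2 := by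
  rw [B1RG242.StepData.Gk1, stepD_γ hℓ hj1 hj ha, stepD_Pk1 hj, Gfine, ← Hfine_add_fineP]
  rfl

/-- **B4 (2.34), ONE STEP, KERNEL-PROVED ON THE BOX** (= B1 (2.42) `B1RG242.StepData.display242` instantiated):
`G_{j+1} = α_j² · G_j Q_j^* C_j Q_j G_j + G_j` with `C_j = s_j^{-2}·C^{(j)}(□)`, `1 ≤ j ≤ k − 1`, on the window
`a > 0`, `m² ≥ 0`. [cite: Balaban1983RegularityDecay, p. 582 (2.34)] [cite: Balaban1982Higgs1, (2.42) p.612] -/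
theorem Gfine_succ (hℓ : 1 ≤ ℓ) (hj1 : 1 ≤ j) (hj : j + 1 ≤ k) (hM : ∀ i, 1 ≤ M i) (ha : 0 < a) (hm : 0 ≤ m2) :
    Gfine ℓ k M (j + 1) a m2
      = αj a ℓ k j ^ 2 •
          (Gfine ℓ k M j a m2 * QksM (bj ℓ j) (Mj ℓ k M j) (Nf ℓ k M) *
            ((sc ℓ k j ^ 2)⁻¹ •
              (covOp (bj ℓ j) ℓ (B1.aSeq a ((ℓ : ℝ) + 1) j) a (m2 / sc ℓ k j ^ 2) (Mp ℓ k M j))⁻¹) *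
            QkM (bj ℓ j) (Mj ℓ k M j) (Nf ℓ k M) * Gfine ℓ k M j a m2)
        + Gfine ℓ k M j a m2 := by
  have h := (stepD ℓ k M j a m2).display242 (stepD_QQs ℓ k M j a m2) (stepD_αβ hℓ hj1 ha)
    (stepD_G_isUnit hℓ hj1 hj hM ha hm) (stepD_C_isUnit hℓ hj1 hj hM ha hm)
  rw [stepD_Gk1 hℓ hj1 hj ha, stepD_Gk hj, stepD_Ck hℓ hj1 hj hM ha hm] at h
  exact h

end Step

/-! ## §6 Weighted row norms, distances between blocks, exponential bookkeeping -/

section RowNorm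

variable {N : Fin (d + 1) → ℕ}

/-- the WEIGHTED `ℓ¹` ROW FUNCTIONAL `Σ_{x′} |T(x,x′)|·e^{δ₀|x − x′|_∞/n}` of a kernel on a box; with `n = L^k` fine
points per unit length, `|x − x′|_∞/n` is the sup-distance in the units of [B4] p. 573 (1.10). [folklore] -/
def roww (δ₀ : ℝ) (n : ℕ) (T : Matrix ↥(boxDom N) ↥(boxDom N) ℝ) (x : ↥(boxDom N)) : ℝ :=
  ∑ x', |T x x'| * Real.exp (δ₀ * supNorm (x.1 - x'.1) / n)

/-- the weighted row functional is nonnegative. [folklore] -/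
theorem roww_nonneg (δ₀ : ℝ) (n : ℕ) (T : Matrix ↥(boxDom N) ↥(boxDom N) ℝ) (x : ↥(boxDom N)) :
    0 ≤ roww δ₀ n T x :=
  Finset.sum_nonneg fun _ _ => mul_nonneg (abs_nonneg _) (Real.exp_pos _).le

/-- subadditivity of the weighted row functional. [folklore] -/
theorem roww_add_le (δ₀ : ℝ) (n : ℕ) (A B : Matrix ↥(boxDom N) ↥(boxDom N) ℝ) (x : ↥(boxDom N)) :
    roww δ₀ n (A + B) x ≤ roww δ₀ n A x + roww δ₀ n B x := by
  unfold roww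
  rw [← Finset.sum_add_distrib]
  refine Finset.sum_le_sum fun x' _ => ?_
  rw [Matrix.add_apply, ← add_mul]
  exact mul_le_mul_of_nonneg_right (abs_add_le _ _) (Real.exp_pos _).le

/-- homogeneity of the weighted row functional. [folklore] -/
theorem roww_smul (δ₀ : ℝ) (n : ℕ) {c : ℝ} (hc : 0 ≤ c) (A : Matrix ↥(boxDom N) ↥(boxDom N) ℝ)
    (x : ↥(boxDom N)) : roww δ₀ n (c • A) x = c * roww δ₀ n A x := by
  unfold roww
  rw [Finset.mul_sum]
  refine Finset.sum_congr rfl fun x' _ => ?_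
  rw [Matrix.smul_apply, smul_eq_mul, abs_mul, abs_of_nonneg hc, mul_assoc]

/-- the plain `ℓ¹` row sum is dominated by the weighted one (`δ₀ ≥ 0`). [folklore] -/
theorem rowSum_le_roww {δ₀ : ℝ} (hδ : 0 ≤ δ₀) (n : ℕ) (T : Matrix ↥(boxDom N) ↥(boxDom N) ℝ)
    (x : ↥(boxDom N)) : ∑ x', |T x x'| ≤ roww δ₀ n T x := by
  unfold roww
  refine Finset.sum_le_sum fun x' _ => ?_
  have h1 : 1 ≤ Real.exp (δ₀ * supNorm (x.1 - x'.1) / n) :=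
    Real.one_le_exp (div_nonneg (mul_nonneg hδ (supNorm_nonneg _)) (Nat.cast_nonneg n))
  calc |T x x'| = |T x x'| * 1 := (mul_one _).symm
    _ ≤ |T x x'| * Real.exp (δ₀ * supNorm (x.1 - x'.1) / n) := mul_le_mul_of_nonneg_left h1 (abs_nonneg _)

/-- **ENTRYWISE EXPONENTIAL DECAY ⇒ WEIGHTED ROW BOUND** (weight rate `δ₀/n ≤ r/2`), through the uniform lattice
sum `Σ_y e^{−(r/2)|x−y|_∞} ≤ K_{d+1}(r/2)` (`rho_sumBound`). [folklore] -/
theorem roww_le_of_decay {n : ℕ} (hn : 1 ≤ n) {T : Matrix ↥(boxDom N) ↥(boxDom N) ℝ} {C₀ r δ₀ : ℝ}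
    (hC : 0 ≤ C₀) (hr : 0 < r) (hδ : 0 ≤ δ₀) (hδr : δ₀ ≤ r / 2)
    (hT : ∀ x y, |T x y| ≤ C₀ * Real.exp (-(r * supNorm (x.1 - y.1)))) (x : ↥(boxDom N)) :
    roww δ₀ n T x ≤ C₀ * latticeConst (d + 1) (r / 2) := by
  unfold roww
  have hS := rho_sumBound N (r / 2) (half_pos hr) x
  have hn1 : (1 : ℝ) ≤ n := by exact_mod_cast hn
  calc ∑ x', |T x x'| * Real.exp (δ₀ * supNorm (x.1 - x'.1) / n)
      ≤ ∑ x', C₀ * Real.exp (-(r / 2 * rho N x x')) := by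
        refine Finset.sum_le_sum fun x' _ => ?_
        have hρ : 0 ≤ supNorm (x.1 - x'.1) := supNorm_nonneg _
        have hw : δ₀ * supNorm (x.1 - x'.1) / n ≤ r / 2 * supNorm (x.1 - x'.1) :=
          calc δ₀ * supNorm (x.1 - x'.1) / n ≤ δ₀ * supNorm (x.1 - x'.1) :=
                div_le_self (mul_nonneg hδ hρ) hn1
            _ ≤ r / 2 * supNorm (x.1 - x'.1) := mul_le_mul_of_nonneg_right hδr hρ
        calc |T x x'| * Real.exp (δ₀ * supNorm (x.1 - x'.1) / n)
            ≤ C₀ * Real.exp (-(r * supNorm (x.1 - x'.1))) * Real.exp (r / 2 * supNorm (x.1 - x'.1)) :=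
              mul_le_mul (hT x x') (Real.exp_le_exp.2 hw) (Real.exp_pos _).le
                (mul_nonneg hC (Real.exp_pos _).le)
          _ = C₀ * Real.exp (-(r / 2 * rho N x x')) := by
              unfold rho
              rw [mul_assoc, ← Real.exp_add]
              congr 1
              congr 1
              ring
    _ = C₀ * ∑ x', Real.exp (-(r / 2 * rho N x x')) := by rw [Finset.mul_sum]
    _ ≤ C₀ * latticeConst (d + 1) (r / 2) := mul_le_mul_of_nonneg_left hS hC

end RowNorm

/-- `K_{d+1}(a) ≥ 1` for `a > 0`. [folklore] -/
theorem one_le_latticeConst (d : ℕ) {a : ℝ} (ha : 0 < a) : 1 ≤ latticeConst (d + 1) a := by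
  unfold latticeConst
  have hD : (0 : ℝ) < ((d + 1 : ℕ) : ℝ) := by positivity
  have he : Real.exp (-(a / ((d + 1 : ℕ) : ℝ))) < 1 := Real.exp_lt_one_iff.2 (by
    have : 0 < a / ((d + 1 : ℕ) : ℝ) := div_pos ha hD
    linarith)
  have he0 : 0 < Real.exp (-(a / ((d + 1 : ℕ) : ℝ))) := Real.exp_pos _
  apply one_le_pow₀
  have h1 : 1 ≤ (1 - Real.exp (-(a / ((d + 1 : ℕ) : ℝ))))⁻¹ := (one_le_inv₀ (by linarith)).2 (by linarith)
  linarith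

/-- `|u − w|_∞ ≤ |u − v|_∞ + |v − w|_∞`. [folklore] -/
theorem supNorm_sub_le_sub_add_sub (u v w : Fin (d + 1) → ℤ) :
    supNorm (u - w) ≤ supNorm (u - v) + supNorm (v - w) := by
  have h : u - w = (u - v) + (v - w) := by abel
  rw [h]
  exact supNorm_add_le _ _

/-- **POINTS OF TWO `b`-BLOCKS ARE AT MOST `b(|β − β′|_∞ + 1)` APART** (`β = blk_b x`, `β′ = blk_b x′`). [folklore] -/
theorem supNorm_sub_le_blk {b : ℕ} (hb : 1 ≤ b) (x x' : Fin (d + 1) → ℤ) :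
    supNorm (x - x') ≤ (b : ℝ) * (supNorm (blk b x - blk b x') + 1) := by
  have hb0 : (0 : ℤ) < b := by exact_mod_cast hb
  have hbR : (0 : ℝ) ≤ b := Nat.cast_nonneg b
  refine supNorm_le_of_forall fun i => ?_
  have h1 : x i % (b : ℤ) + x i / (b : ℤ) * b = x i := Int.emod_add_ediv_mul (x i) b
  have h2 : x' i % (b : ℤ) + x' i / (b : ℤ) * b = x' i := Int.emod_add_ediv_mul (x' i) b
  have h3 : 0 ≤ x i % (b : ℤ) := Int.emod_nonneg (x i) hb0.ne'
  have h4 : x i % (b : ℤ) < b := Int.emod_lt_of_pos (x i) hb0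
  have h5 : 0 ≤ x' i % (b : ℤ) := Int.emod_nonneg (x' i) hb0.ne'
  have h6 : x' i % (b : ℤ) < b := Int.emod_lt_of_pos (x' i) hb0
  have hβ : (((|(blk b x - blk b x') i| : ℤ)) : ℝ) ≤ supNorm (blk b x - blk b x') := abs_le_supNorm _ i
  have hβ' : (blk b x - blk b x') i = x i / (b : ℤ) - x' i / (b : ℤ) := rfl
  rw [hβ'] at hβ
  have h7 : |x i - x' i| ≤ (b : ℤ) * |x i / (b : ℤ) - x' i / (b : ℤ)| + ((b : ℤ) - 1) := by
    have e : x i - x' i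
        = (b : ℤ) * (x i / (b : ℤ) - x' i / (b : ℤ)) + (x i % (b : ℤ) - x' i % (b : ℤ)) := by
      linear_combination -h1 + h2
    rw [e]
    have hrr : |x i % (b : ℤ) - x' i % (b : ℤ)| ≤ (b : ℤ) - 1 := abs_le.2 ⟨by linarith, by linarith⟩
    calc |(b : ℤ) * (x i / (b : ℤ) - x' i / (b : ℤ)) + (x i % (b : ℤ) - x' i % (b : ℤ))|
        ≤ |(b : ℤ) * (x i / (b : ℤ) - x' i / (b : ℤ))| + |x i % (b : ℤ) - x' i % (b : ℤ)| := abs_add_le _ _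
      _ = (b : ℤ) * |x i / (b : ℤ) - x' i / (b : ℤ)| + |x i % (b : ℤ) - x' i % (b : ℤ)| := by
          rw [abs_mul, abs_of_pos hb0]
      _ ≤ _ := by linarith
  have h8 : (((|(x - x') i| : ℤ)) : ℝ)
      ≤ (b : ℝ) * (((|x i / (b : ℤ) - x' i / (b : ℤ)| : ℤ)) : ℝ) + ((b : ℝ) - 1) := by
    rw [Pi.sub_apply]
    exact_mod_cast h7
  linarith [mul_le_mul_of_nonneg_left hβ hbR]

/-- **MERGING THE WEIGHT INTO THREE DECAYING FACTORS**: if `w ≤ δ₀(p + q + r + 1)` and `δ₀ ≤ κ/2, δ/2`, then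
`e^{w}·(e^{−κp}e^{−δq}e^{−κr}) ≤ e^{δ₀}·(e^{−κp/2}e^{−δq/2}e^{−κr/2})`. [folklore] -/
theorem exp_merge {δ₀ κ δ p q r w : ℝ} (hp : 0 ≤ p) (hq : 0 ≤ q) (hr : 0 ≤ r)
    (h1 : δ₀ ≤ κ / 2) (h2 : δ₀ ≤ δ / 2) (hw : w ≤ δ₀ * (p + q + r + 1)) :
    Real.exp w * (Real.exp (-(κ * p)) * Real.exp (-(δ * q)) * Real.exp (-(κ * r)))
      ≤ Real.exp δ₀ * (Real.exp (-(κ / 2 * p)) * Real.exp (-(δ / 2 * q)) * Real.exp (-(κ / 2 * r))) := by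
  simp only [← Real.exp_add]
  have k1 := mul_nonneg (sub_nonneg.2 h1) hp
  have k2 := mul_nonneg (sub_nonneg.2 h2) hq
  have k3 := mul_nonneg (sub_nonneg.2 h1) hr
  exact Real.exp_le_exp.2 (by nlinarith)

open Beta.BlockPoincare (coercive_of_blockPoincare)

/-! ## §7 The one-step box operator: coercivity, locality, condition (5.6) and the decay of its inverse

This is the base of the induction over `j`: for `j = 1` (and for `k = 1`) the propagator of Part A is
`L^{-2(k-1)}·B^{-1}` with `B = boxOpR(L, a₁, m′², M′)` the ONE-STEP box operator `L²(−Δ^N) + m′² + a₁P_L`, whose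
coercivity `B ≥ min(L²/(ℓ(ℓ+1)), a₁)` follows from the Poincaré inequality on `L`-blocks (`lblock_poincare`) and whose
kernel is supported in `opSupp` (range `≤ L`); [B4] Lemma 5.2 (`B4Sect5Torus.inv_decay`, Combes–Thomas) then gives
the exponential decay of `B^{-1}`. -/

/-- the one-step box operator splits as its `a = 0` part plus `a·P` (`P = blockAvgP`, the `L`-block averaging). [folklore] -/
theorem boxOpR_L_apply (ℓ : ℕ) (a m2 : ℝ) (M' : Fin (d + 1) → ℕ) (x y : ↥(boxDom (fun i => (ℓ + 1) * M' i))) :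
    boxOpR (ℓ + 1) a m2 M' x y = boxOpR (ℓ + 1) 0 m2 M' x y + a * blockAvgP ℓ M' x y := by
  by_cases h : blk (ℓ + 1) y.1 = blk (ℓ + 1) x.1
  · simp only [boxOpR, opBoxR, blockAvgP, Matrix.of_apply, avgK, if_pos h, if_pos h.symm]
    push_cast
    ring
  · simp only [boxOpR, opBoxR, blockAvgP, Matrix.of_apply, avgK, if_neg h, if_neg (Ne.symm h)]
    push_cast
    ring

/-- the quadratic form of the one-step box operator: `⟨ω,Bω⟩ = ⟨ω,B₀ω⟩ + a⟨ω,Pω⟩`. [folklore] -/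
theorem boxOpR_L_form (ℓ : ℕ) (a m2 : ℝ) (M' : Fin (d + 1) → ℕ)
    (ω : ↥(boxDom (fun i => (ℓ + 1) * M' i)) → ℝ) :
    ω ⬝ᵥ (boxOpR (ℓ + 1) a m2 M') *ᵥ ω
      = ω ⬝ᵥ (boxOpR (ℓ + 1) 0 m2 M') *ᵥ ω + a * (ω ⬝ᵥ (blockAvgP ℓ M') *ᵥ ω) := by
  have h : boxOpR (ℓ + 1) a m2 M' = boxOpR (ℓ + 1) 0 m2 M' + a • blockAvgP ℓ M' := by
    ext x y
    rw [Matrix.add_apply, Matrix.smul_apply, smul_eq_mul]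
    exact boxOpR_L_apply ℓ a m2 M' x y
  rw [h, Matrix.add_mulVec, dotProduct_add, Matrix.smul_mulVec, dotProduct_smul, smul_eq_mul]

/-- **COERCIVITY OF THE ONE-STEP BOX OPERATOR**: `⟨ω, Bω⟩ ≥ min((L²/2)/(ℓ(ℓ+1)/2), a)·‖ω‖²` — the block Poincaré
inequality `lblock_poincare` through `Beta.BlockPoincare.coercive_of_blockPoincare`. [folklore] -/
theorem boxOpR_L_form_ge {ℓ : ℕ} (hℓ : 1 ≤ ℓ) {a m2 : ℝ} (ha : 0 ≤ a) (hm : 0 ≤ m2) (M' : Fin (d + 1) → ℕ)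
    (ω : ↥(boxDom (fun i => (ℓ + 1) * M' i)) → ℝ) :
    min ((((ℓ : ℝ) + 1) ^ 2 / 2) / ((ℓ : ℝ) * (ℓ + 1) / 2)) a * (ω ⬝ᵥ ω)
      ≤ ω ⬝ᵥ (boxOpR (ℓ + 1) a m2 M') *ᵥ ω := by
  have hℓ1 : (1 : ℝ) ≤ ℓ := by exact_mod_cast hℓ
  have hP : (0 : ℝ) < (ℓ : ℝ) * (ℓ + 1) / 2 := by positivity
  refine coercive_of_blockPoincare (lblk ℓ M') bsrc btgt _ hP (lblock_poincare hℓ M')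
    (boxOpR (ℓ + 1) a m2 M') _ _ (by positivity) ha ?_ ω
  intro ω
  rw [sum_UBond_eq_dirBox, ← blockAvgP_form, boxOpR_L_form]
  have hE := fineEnergy_eq (n := ℓ + 1) (by omega) 0 m2 M' ω
  simp only [zero_mul, sub_zero] at hE
  push_cast at hE
  have hdir := dirBox_extB_le_bondSum ω
  have hm2 : 0 ≤ m2 * ∑ x, ω x ^ 2 := mul_nonneg hm (Finset.sum_nonneg fun _ _ => sq_nonneg _)
  have h2 : (0 : ℝ) ≤ ((ℓ : ℝ) + 1) ^ 2 / 2 := by positivity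
  have h3 := mul_le_mul_of_nonneg_left hdir h2
  linarith

/-- **LOCALITY AND BOUNDEDNESS OF THE BOX OPERATOR'S KERNEL**: `boxOpR(n,a,m²,M)(x,y)` vanishes unless
`y ∈ opSupp_n(x)` (sup-distance `≤ n`), and `|entry| ≤ 2(d+1)n² + |m²₊| + |a₊|` on the window; hence the crude
decay bound `|B(x,y)| ≤ c_B e^{n}·e^{−|x−y|_∞}`. [folklore] -/
theorem boxOpR_entry_le {n : ℕ} (hn : 1 ≤ n) {a m2 aplus m2plus : ℝ} (ha : 0 ≤ a) (h2 : a ≤ aplus)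
    (hm : 0 ≤ m2) (h4 : m2 ≤ m2plus) (M : Fin (d + 1) → ℕ) (x y : ↥(boxDom (fun i => n * M i))) :
    |boxOpR n a m2 M x y|
      ≤ (2 * ((d : ℝ) + 1) * (n : ℝ) ^ 2 + |m2plus| + |aplus|) * Real.exp (n : ℝ)
          * Real.exp (-(1 * rho (fun i => n * M i) x y)) := by
  have hcB0 : 0 ≤ 2 * ((d : ℝ) + 1) * (n : ℝ) ^ 2 + |m2plus| + |aplus| := by positivity
  by_cases hxy : y.1 ∈ opSupp n x.1
  · have hdist : rho (fun i => n * M i) x y ≤ n := by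
      unfold rho
      rw [← B4TorusKernel.supNorm_neg, neg_sub]
      exact supNorm_sub_le_of_mem_opSupp hn hxy
    have hΔ : |(neumannLapK (fun i => n * M i) x.1 y.1 : ℝ)| ≤ 2 * ((d : ℝ) + 1) := by
      unfold neumannLapK
      split_ifs with h1 h2
      · rw [Nat.abs_cast]
        have hc := Finset.card_filter_le (nbrs x.1) (fun z => z ∈ boxDom (fun i => n * M i))
        rw [card_nbrs] at hc
        exact_mod_cast hc
      · rw [abs_neg, abs_one]
        have : (0 : ℝ) ≤ d := Nat.cast_nonneg d
        linarith
      · rw [abs_zero]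
        positivity
    have hD : |(diagK m2 x.1 y.1 : ℝ)| ≤ |m2plus| := by
      unfold diagK
      split_ifs
      · rw [abs_of_nonneg hm]
        exact h4.trans (le_abs_self _)
      · rw [abs_zero]
        exact abs_nonneg _
    have hA : |(avgK (a * ((n : ℝ) ^ (d + 1))⁻¹) n x.1 y.1 : ℝ)| ≤ |aplus| := by
      unfold avgK
      split_ifs
      · rw [abs_of_nonneg (by positivity)]
        have hn1 : (1 : ℝ) ≤ (n : ℝ) ^ (d + 1) := one_le_pow₀ (by exact_mod_cast hn)
        calc a * ((n : ℝ) ^ (d + 1))⁻¹ ≤ a * 1 :=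
              mul_le_mul_of_nonneg_left (inv_le_one_of_one_le₀ hn1) ha
          _ ≤ |aplus| := by rw [mul_one]; exact h2.trans (le_abs_self _)
      · rw [abs_zero]
        exact abs_nonneg _
    have hval : |boxOpR n a m2 M x y| ≤ 2 * ((d : ℝ) + 1) * (n : ℝ) ^ 2 + |m2plus| + |aplus| := by
      simp only [boxOpR, opBoxR, Matrix.of_apply]
      calc |(n : ℝ) ^ 2 * neumannLapK (fun i => n * M i) x.1 y.1
              + (diagK m2 x.1 y.1 + avgK (a * ((n : ℝ) ^ (d + 1))⁻¹) n x.1 y.1)|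
          ≤ |(n : ℝ) ^ 2 * neumannLapK (fun i => n * M i) x.1 y.1|
              + (|diagK m2 x.1 y.1| + |avgK (a * ((n : ℝ) ^ (d + 1))⁻¹) n x.1 y.1|) :=
            (abs_add_le _ _).trans (add_le_add le_rfl (abs_add_le _ _))
        _ ≤ (n : ℝ) ^ 2 * (2 * ((d : ℝ) + 1)) + (|m2plus| + |aplus|) := by
            rw [abs_mul, abs_of_nonneg (by positivity : (0 : ℝ) ≤ (n : ℝ) ^ 2)]
            exact add_le_add (mul_le_mul_of_nonneg_left hΔ (by positivity)) (add_le_add hD hA)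
        _ = 2 * ((d : ℝ) + 1) * (n : ℝ) ^ 2 + |m2plus| + |aplus| := by ring
    have hexp : 1 ≤ Real.exp (n : ℝ) * Real.exp (-(1 * rho (fun i => n * M i) x y)) := by
      rw [← Real.exp_add]
      exact Real.one_le_exp (by linarith)
    calc |boxOpR n a m2 M x y| ≤ (2 * ((d : ℝ) + 1) * (n : ℝ) ^ 2 + |m2plus| + |aplus|) * 1 := by
          rw [mul_one]; exact hval
      _ ≤ (2 * ((d : ℝ) + 1) * (n : ℝ) ^ 2 + |m2plus| + |aplus|)
            * (Real.exp (n : ℝ) * Real.exp (-(1 * rho (fun i => n * M i) x y))) :=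
          mul_le_mul_of_nonneg_left hexp hcB0
      _ = _ := by ring
  · have h0 : boxOpR n a m2 M x y = 0 := by
      simp only [opSupp, Finset.mem_union, Finset.mem_insert, not_or] at hxy
      obtain ⟨⟨h1, h2⟩, h3⟩ := hxy
      rw [mem_blockOf hn] at h3
      simp only [boxOpR, opBoxR, Matrix.of_apply, neumannLapK, diagK, avgK, if_neg h1, if_neg h2, if_neg h3]
      ring
    rw [h0, abs_zero]
    positivity

/-- **CONDITION (5.6) FOR THE ONE-STEP BOX OPERATOR**, uniformly on the window `a ∈ [a₋, a₊]`, `m² ∈ [0, m²₊]`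
and in the box: `Hyp56 (rho) (boxOpR L a m² M′) γ₀ c₀ 1` with `γ₀ = min((L²/2)/(ℓ(ℓ+1)/2), a₋)`,
`c₀ = (2(d+1)L² + |m²₊| + |a₊|)e^{L}`.  (Stated for `n = ℓ + 1` through an equation so that it applies verbatim
to the carrier `(ℓ+1)^1`.) [folklore] -/
theorem boxOpR_L_hyp56 (d ℓ : ℕ) (hℓ : 1 ≤ ℓ) (amin aplus m2plus : ℝ) (ha : 0 < amin) :
    ∃ γ₀ c₀ : ℝ, 0 < γ₀ ∧ 0 ≤ c₀ ∧ ∀ (n : ℕ), n = ℓ + 1 → ∀ (a m2 : ℝ), amin ≤ a → a ≤ aplus → 0 ≤ m2 →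
      m2 ≤ m2plus → ∀ (M' : Fin (d + 1) → ℕ),
        Hyp56 (rho (fun i => n * M' i)) (boxOpR n a m2 M') γ₀ c₀ 1 := by
  have hℓ1 : (1 : ℝ) ≤ ℓ := by exact_mod_cast hℓ
  have hP : (0 : ℝ) < (ℓ : ℝ) * (ℓ + 1) / 2 := by positivity
  refine ⟨min ((((ℓ : ℝ) + 1) ^ 2 / 2) / ((ℓ : ℝ) * (ℓ + 1) / 2)) amin,
    (2 * ((d : ℝ) + 1) * (((ℓ + 1 : ℕ) : ℝ)) ^ 2 + |m2plus| + |aplus|) * Real.exp (((ℓ + 1 : ℕ) : ℝ)),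
    lt_min (by positivity) ha, by positivity, ?_⟩
  intro n hn a m2 h1 h2 h3 h4 M'
  subst hn
  have ha0 : 0 ≤ a := ha.le.trans h1
  refine ⟨opBoxR_isSymm _ _ _ _ _, fun v => ?_, fun p q => boxOpR_entry_le (by omega) ha0 h2 h3 h4 M' p q⟩
  have hvv : ∑ p, v p ^ 2 = v ⬝ᵥ v := by
    unfold dotProduct
    exact Finset.sum_congr rfl fun p _ => by ring
  have hvv0 : 0 ≤ v ⬝ᵥ v := by
    rw [← hvv]
    exact Finset.sum_nonneg fun _ _ => sq_nonneg _
  rw [hvv]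
  show _ * (v ⬝ᵥ v) ≤ v ⬝ᵥ (boxOpR (ℓ + 1) a m2 M').mulVec v
  have hge := boxOpR_L_form_ge hℓ ha0 h3 M' v
  exact (mul_le_mul_of_nonneg_right (min_le_min le_rfl h1) hvv0).trans hge

/-- **EXPONENTIAL DECAY OF THE ONE-STEP BOX GREEN'S FUNCTION** `B^{-1} = (L²(−Δ^N) + m² + aP_L)^{-1}_□`, uniformly
on the window and in the box: `|B^{-1}(p,q)| ≤ C₀e^{−r|p−q|_∞}` ([B4] Lemma 5.2 = `B4Sect5Torus.inv_decay`). [folklore] -/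
theorem boxOpR_L_inv_decay (d ℓ : ℕ) (hℓ : 1 ≤ ℓ) (amin aplus m2plus : ℝ) (ha : 0 < amin) :
    ∃ r C₀ : ℝ, 0 < r ∧ 0 < C₀ ∧ ∀ (n : ℕ), n = ℓ + 1 → ∀ (a m2 : ℝ), amin ≤ a → a ≤ aplus → 0 ≤ m2 →
      m2 ≤ m2plus → ∀ (M' : Fin (d + 1) → ℕ) (p q : ↥(boxDom (fun i => n * M' i))),
        |(boxOpR n a m2 M')⁻¹ p q| ≤ C₀ * Real.exp (-(r * supNorm (p.1 - q.1))) := by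
  obtain ⟨γ₀, c₀, hγ, hc, h⟩ := boxOpR_L_hyp56 d ℓ hℓ amin aplus m2plus ha
  have hK : ∀ t : ℝ, 0 < t → 0 ≤ latticeConst (d + 1) t := fun t ht => latticeConst_nonneg _ ht.le
  refine ⟨rate (latticeConst (d + 1)) γ₀ c₀ 1, 2 / γ₀, rate_pos hK hγ hc one_pos, by positivity, ?_⟩
  intro n hn a m2 h1 h2 h3 h4 M' p q
  have hd := inv_decay hK hγ hc one_pos (rho_isPseudoDist _) (rho_sumBound _) (h n hn a m2 h1 h2 h3 h4 M') p q
  unfold rho at hd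
  exact hd

/-! ## §8 The fluctuation term of one renormalization step in the weighted row norm

With `A_j = 𝒢_jQ_j^*` (fine × unit), `B_j = Q_j𝒢_j` (unit × fine) and `C_j = L^{-2(k-j)}C^{(j)}(□)` (unit × unit)
the recursion (2.35) reads `𝒢_{j+1} − 𝒢_j = α_j²·A_jC_jB_j`.  Row/column bounds: `|A_j(x,y)|, L^{j(d+1)}|B_j(y,x)|
≤ L^{-2(k-j)}C₁e^{−κ|blk x − y|}` (Part A, (2.35) row form), `|C_j(y,y′)| ≤ L^{-2(k-j)}c₂e^{−δ|y−y′|}` ((2.37),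
`cov237_box_decay`); the weight `e^{δ₀|x−x′|/L^k}` is absorbed by halving the three rates (`exp_merge`, using
`|x − x′| ≤ L^j(|blk x − y| + |y − y′| + |y′ − blk x′| + 1)` and `L^k = L^{k-j}·L^j`), and the three geometric sums
cost `K(κ/2)²K(δ/2)·L^{j(d+1)}`, the last factor cancelling the `L^{-j(d+1)}` of `Q_j`.  Net:
`‖𝒢_{j+1} − 𝒢_j‖_{row,δ₀} ≤ Θe^{δ₀}·L^{-2(k-j)}` — summable in `j`. -/

section StepBound

variable {ℓ k j : ℕ} {M : Fin (d + 1) → ℕ} {a m2 : ℝ}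

/-- `A_j = 𝒢_j Q_j^*` (fine × unit). [folklore] -/
def Amat (ℓ k : ℕ) (M : Fin (d + 1) → ℕ) (j : ℕ) (a m2 : ℝ) :
    Matrix ↥(boxDom (Nf ℓ k M)) ↥(boxDom (Mj ℓ k M j)) ℝ :=
  Gfine ℓ k M j a m2 * QksM (bj ℓ j) (Mj ℓ k M j) (Nf ℓ k M)

/-- `B_j = Q_j 𝒢_j` (unit × fine). [folklore] -/
def Bmat (ℓ k : ℕ) (M : Fin (d + 1) → ℕ) (j : ℕ) (a m2 : ℝ) :
    Matrix ↥(boxDom (Mj ℓ k M j)) ↥(boxDom (Nf ℓ k M)) ℝ :=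
  QkM (bj ℓ j) (Mj ℓ k M j) (Nf ℓ k M) * Gfine ℓ k M j a m2

/-- `C_j = L^{-2(k-j)}·C^{(j)}(□)` in `L^{-k}`-units (unit × unit). [folklore] -/
def Cmat (ℓ k : ℕ) (M : Fin (d + 1) → ℕ) (j : ℕ) (a m2 : ℝ) :
    Matrix ↥(boxDom (Mj ℓ k M j)) ↥(boxDom (Mj ℓ k M j)) ℝ :=
  (sc ℓ k j ^ 2)⁻¹ • (covOp (bj ℓ j) ℓ (B1.aSeq a ((ℓ : ℝ) + 1) j) a (m2 / sc ℓ k j ^ 2) (Mp ℓ k M j))⁻¹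

/-- **THE FLUCTUATION TERM OF (2.34)**: `𝒢_{j+1} − 𝒢_j = α_j²·A_jC_jB_j`. [folklore] -/
theorem Gfine_succ_sub (hℓ : 1 ≤ ℓ) (hj1 : 1 ≤ j) (hj : j + 1 ≤ k) (hM : ∀ i, 1 ≤ M i) (ha : 0 < a)
    (hm : 0 ≤ m2) :
    Gfine ℓ k M (j + 1) a m2 - Gfine ℓ k M j a m2
      = αj a ℓ k j ^ 2 • (Amat ℓ k M j a m2 * Cmat ℓ k M j a m2 * Bmat ℓ k M j a m2) := by
  rw [Gfine_succ hℓ hj1 hj hM ha hm, add_sub_cancel_right]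
  simp only [Amat, Bmat, Cmat, Matrix.mul_assoc]

/-- a triple-sum bookkeeping inequality: `Σ_{x′}Σ_{y′}Σ_y f(y)g(y,y′)h(y′,x′) ≤ F·G·H` from the three
one-variable sums. [folklore] -/
theorem sum3_le {α β γ : Type*} [Fintype α] [Fintype β] [Fintype γ]
    (f : β → ℝ) (g : β → γ → ℝ) (h : γ → α → ℝ)
    (hf : ∀ y, 0 ≤ f y) (hg : ∀ y y', 0 ≤ g y y') {F G H : ℝ} (hG0 : 0 ≤ G) (hH0 : 0 ≤ H)
    (hF : ∑ y, f y ≤ F) (hG : ∀ y, ∑ y', g y y' ≤ G) (hH : ∀ y', ∑ x', h y' x' ≤ H) :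
    ∑ x', ∑ y', ∑ y, f y * g y y' * h y' x' ≤ F * G * H := by
  calc ∑ x', ∑ y', ∑ y, f y * g y y' * h y' x'
      = ∑ y', ∑ y, f y * g y y' * ∑ x', h y' x' := by
        conv_lhs => rw [Finset.sum_comm]
        refine Finset.sum_congr rfl fun y' _ => ?_
        conv_lhs => rw [Finset.sum_comm]
        refine Finset.sum_congr rfl fun y _ => ?_
        rw [Finset.mul_sum]
    _ ≤ ∑ y', ∑ y, f y * g y y' * H :=
        Finset.sum_le_sum fun y' _ => Finset.sum_le_sum fun y _ =>
          mul_le_mul_of_nonneg_left (hH y') (mul_nonneg (hf y) (hg y y'))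
    _ = H * ∑ y, (f y * ∑ y', g y y') := by
        rw [Finset.sum_comm, Finset.mul_sum]
        refine Finset.sum_congr rfl fun y _ => ?_
        rw [Finset.mul_sum, Finset.mul_sum]
        exact Finset.sum_congr rfl fun y' _ => by ring
    _ ≤ H * ∑ y, f y * G := by
        refine mul_le_mul_of_nonneg_left (Finset.sum_le_sum fun y _ => ?_) hH0
        exact mul_le_mul_of_nonneg_left (hG y) (hf y)
    _ = H * G * ∑ y, f y := by rw [← Finset.sum_mul]; ring
    _ ≤ H * G * F := mul_le_mul_of_nonneg_left hF (mul_nonneg hH0 hG0)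
    _ = F * G * H := by ring

/-- **THE FIBRE SUM**: `Σ_{x′ ∈ fine box} e^{−t|blk x′ − y′|} = L^{j(d+1)}Σ_{y″ ∈ unit box} e^{−t|y″ − y′|}
≤ L^{j(d+1)}K(t)` (every `L^j`-block has `L^{j(d+1)}` points, `card_filter_blk`). [folklore] -/
theorem fibre_sum_le (hj : j + 1 ≤ k) (M : Fin (d + 1) → ℕ) {t : ℝ} (ht : 0 < t)
    (y' : ↥(boxDom (Mj ℓ k M j))) :
    ∑ x' : ↥(boxDom (Nf ℓ k M)), Real.exp (-(t * supNorm (blk (bj ℓ j) x'.1 - y'.1)))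
      ≤ ((bj ℓ j : ℕ) : ℝ) ^ (d + 1) * latticeConst (d + 1) t := by
  rw [sum_Nf_eq_sum_ej hj M]
  have hval : ∀ z : ↥(boxDom (fun i => bj ℓ j * Mj ℓ k M j i)), (ej ℓ k M j hj z).1 = z.1 := fun z => rfl
  simp_rw [hval]
  have hmaps : ∀ z ∈ (Finset.univ : Finset ↥(boxDom (fun i => bj ℓ j * Mj ℓ k M j i))),
      (⟨blk (bj ℓ j) z.1, blk_mem_boxDom (bj_pos ℓ j) z.2⟩ : ↥(boxDom (Mj ℓ k M j)))
        ∈ (Finset.univ : Finset ↥(boxDom (Mj ℓ k M j))) := fun _ _ => Finset.mem_univ _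
  rw [← Finset.sum_fiberwise_of_maps_to hmaps]
  have hS := rho_sumBound (Mj ℓ k M j) t ht y'
  have hfib : ∀ y'' : ↥(boxDom (Mj ℓ k M j)),
      ∑ z ∈ Finset.univ.filter (fun z : ↥(boxDom (fun i => bj ℓ j * Mj ℓ k M j i)) =>
          (⟨blk (bj ℓ j) z.1, blk_mem_boxDom (bj_pos ℓ j) z.2⟩ : ↥(boxDom (Mj ℓ k M j))) = y''),
        Real.exp (-(t * supNorm (blk (bj ℓ j) z.1 - y'.1)))
        = ((bj ℓ j : ℕ) : ℝ) ^ (d + 1) * Real.exp (-(t * rho (Mj ℓ k M j) y' y'')) := by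
    intro y''
    rw [Finset.sum_congr rfl (g := fun _ => Real.exp (-(t * rho (Mj ℓ k M j) y' y''))) fun z hz => by
      have hz' : blk (bj ℓ j) z.1 = y''.1 := congrArg Subtype.val (Finset.mem_filter.1 hz).2
      rw [hz']
      unfold rho
      rw [← B4TorusKernel.supNorm_neg, neg_sub]]
    rw [Finset.sum_const, nsmul_eq_mul]
    congr 1
    rw [← Nat.cast_pow, ← card_filter_blk (bj_pos ℓ j) (Mj ℓ k M j) y'', Nat.cast_inj]
    exact congrArg Finset.card (Finset.filter_congr fun z _ => Subtype.ext_iff)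
  rw [Finset.sum_congr rfl fun y'' _ => hfib y'', ← Finset.mul_sum]
  exact mul_le_mul_of_nonneg_left hS (by positivity)

set_option maxHeartbeats 1600000 in
/-- **THE STEP BOUND**: there are `κ₀ > 0` and `Θ ≥ 0` (depending on `d, ℓ` and the window only) such that for
every weight rate `0 ≤ δ₀ ≤ κ₀`, every `1 ≤ j < k`, every point of the window and every box,
`‖𝒢_{j+1} − 𝒢_j‖_{row,δ₀}(x) ≤ Θe^{δ₀}·L^{-2(k-j)}`. [folklore] -/
theorem step_term_bound (d ℓ : ℕ) (hℓ : 1 ≤ ℓ) (amin aplus m2plus : ℝ) (ha : 0 < amin) :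
    ∃ κ₀ Θ : ℝ, 0 < κ₀ ∧ 0 ≤ Θ ∧ ∀ (δ₀ : ℝ), 0 ≤ δ₀ → δ₀ ≤ κ₀ →
      ∀ (k j : ℕ), 1 ≤ j → ∀ (hj : j + 1 ≤ k), ∀ (a m2 : ℝ), amin ≤ a → a ≤ aplus → 0 ≤ m2 →
        m2 ≤ m2plus → ∀ (M : Fin (d + 1) → ℕ), (∀ i, 1 ≤ M i) → ∀ (x : ↥(boxDom (Nf ℓ k M))),
          roww δ₀ ((ℓ + 1) ^ k) (Gfine ℓ k M (j + 1) a m2 - Gfine ℓ k M j a m2) x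
            ≤ Θ * Real.exp δ₀ * (sc ℓ k j ^ 2)⁻¹ := by
  obtain ⟨κ, C₁, hκ, hC₁, hR⟩ := Gfine_blockRow_bound d ℓ hℓ amin aplus m2plus ha
  obtain ⟨δ, c₂, hδ, hc₂, hCov⟩ := cov237_box_decay d ℓ hℓ (amin * (1 - ((((ℓ : ℝ) + 1)) ^ 2)⁻¹)) aplus
    m2plus amin aplus (aminus'_pos hℓ ha) ha
  have hK0 : ∀ t : ℝ, 0 < t → 0 ≤ latticeConst (d + 1) t := fun t ht => latticeConst_nonneg _ ht.le
  have hKκ := hK0 _ (half_pos hκ)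
  have hKδ := hK0 _ (half_pos hδ)
  refine ⟨min κ δ / 2, aplus ^ 2 * (C₁ * c₂ * C₁)
      * (latticeConst (d + 1) (κ / 2) * latticeConst (d + 1) (δ / 2) * latticeConst (d + 1) (κ / 2)),
    by positivity, ?_, ?_⟩
  · exact mul_nonneg (mul_nonneg (sq_nonneg _) (mul_nonneg (mul_nonneg hC₁ hc₂.le) hC₁))
      (mul_nonneg (mul_nonneg hKκ hKδ) hKκ)
  intro δ₀ hδ0 hδ1 k j hj1 hj a m2 h1 h2 h3 h4 M hM x
  -- windows and positivity
  have ha0 : 0 < a := lt_of_lt_of_le ha h1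
  obtain ⟨hw1, hw2, hapos⟩ := aSeq_window hℓ ha h1 h2 hj1
  have hs : 0 < sc ℓ k j ^ 2 := pow_pos (sc_pos ℓ k j) 2
  have hsi : 0 < (sc ℓ k j ^ 2)⁻¹ := inv_pos.2 hs
  have hsc0 : sc ℓ k j ≠ 0 := (sc_pos ℓ k j).ne'
  have hm' : 0 ≤ m2 / sc ℓ k j ^ 2 := div_nonneg h3 hs.le
  have hm'' : m2 / sc ℓ k j ^ 2 ≤ m2plus :=
    (div_le_self h3 (one_le_pow₀ (one_le_sc ℓ k j))).trans h4
  have hb1 : 1 ≤ bj ℓ j := bj_pos ℓ j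
  have hbD : (0 : ℝ) < ((bj ℓ j : ℕ) : ℝ) ^ (d + 1) := by positivity
  have hbD0 : ((bj ℓ j : ℕ) : ℝ) ≠ 0 := by positivity
  have hδκ : δ₀ ≤ κ / 2 := hδ1.trans (by linarith [min_le_left κ δ])
  have hδδ : δ₀ ≤ δ / 2 := hδ1.trans (by linarith [min_le_right κ δ])
  -- entry bounds of the three kernels
  have hA : ∀ (x : ↥(boxDom (Nf ℓ k M))) (y : ↥(boxDom (Mj ℓ k M j))),
      |Amat ℓ k M j a m2 x y|
        ≤ (sc ℓ k j ^ 2)⁻¹ * C₁ * Real.exp (-(κ * supNorm (blk (bj ℓ j) x.1 - y.1))) := by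
    intro x y
    have hAxy : Amat ℓ k M j a m2 x y
        = ∑ x', (if blk (bj ℓ j) x'.1 = y.1 then Gfine ℓ k M j a m2 x x' else 0) := by
      simp only [Amat, Matrix.mul_apply, QksM, Matrix.of_apply, mul_ite, mul_one, mul_zero]
    rw [hAxy]
    exact hR k j hj1 hj a m2 h1 h2 h3 h4 M hM x y.1 y.2
  have hB : ∀ (y' : ↥(boxDom (Mj ℓ k M j))) (x' : ↥(boxDom (Nf ℓ k M))),
      |Bmat ℓ k M j a m2 y' x'| ≤ ((((bj ℓ j : ℕ) : ℝ)) ^ (d + 1))⁻¹ *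
        ((sc ℓ k j ^ 2)⁻¹ * C₁ * Real.exp (-(κ * supNorm (blk (bj ℓ j) x'.1 - y'.1)))) := by
    intro y' x'
    have hBe : Bmat ℓ k M j a m2 y' x' = ((((bj ℓ j : ℕ) : ℝ)) ^ (d + 1))⁻¹ *
        ∑ w, (if blk (bj ℓ j) w.1 = y'.1 then Gfine ℓ k M j a m2 x' w else 0) := by
      simp only [Bmat, Matrix.mul_apply, QkM, Matrix.of_apply, Finset.mul_sum]
      refine Finset.sum_congr rfl fun w _ => ?_
      split_ifs with hw
      · rw [(Gfine_isSymm ℓ k M j a m2).apply x' w]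
      · rw [zero_mul, mul_zero]
    rw [hBe, abs_mul, abs_of_pos (inv_pos.2 hbD)]
    exact mul_le_mul_of_nonneg_left (hR k j hj1 hj a m2 h1 h2 h3 h4 M hM x' y'.1 y'.2) (inv_pos.2 hbD).le
  have hC : ∀ (y y' : ↥(boxDom (Mj ℓ k M j))),
      |Cmat ℓ k M j a m2 y y'| ≤ (sc ℓ k j ^ 2)⁻¹ * (c₂ * Real.exp (-(δ * supNorm (y.1 - y'.1)))) := by
    intro y y'
    have h := (hCov (bj ℓ j) hb1 _ _ a hw1 hw2 hm' hm'' h1 h2 (Mp ℓ k M j) (Mp_pos hM)).2 y y'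
    rw [Cmat, Matrix.smul_apply, smul_eq_mul, abs_mul, abs_of_pos hsi]
    exact mul_le_mul_of_nonneg_left h hsi.le
  -- the weight: `|x − x′|/L^k ≤ |blk x − y| + |y − y′| + |blk x′ − y′| + 1`
  have hnR : ((((ℓ + 1) ^ k : ℕ)) : ℝ) = sc ℓ k j * ((bj ℓ j : ℕ) : ℝ) := by
    rw [sc_mul_bj (by omega : j ≤ k)]
    push_cast
    ring
  have hn0 : (0 : ℝ) < (((ℓ + 1) ^ k : ℕ) : ℝ) := by positivity
  have hwt : ∀ (x x' : ↥(boxDom (Nf ℓ k M))) (y y' : ↥(boxDom (Mj ℓ k M j))),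
      δ₀ * supNorm (x.1 - x'.1) / (((ℓ + 1) ^ k : ℕ) : ℝ)
        ≤ δ₀ * (supNorm (blk (bj ℓ j) x.1 - y.1) + supNorm (y.1 - y'.1)
            + supNorm (blk (bj ℓ j) x'.1 - y'.1) + 1) := by
    intro x x' y y'
    rw [mul_div_assoc]
    refine mul_le_mul_of_nonneg_left ?_ hδ0
    rw [div_le_iff₀ hn0, hnR]
    have t1 := supNorm_sub_le_sub_add_sub (blk (bj ℓ j) x.1) y.1 (blk (bj ℓ j) x'.1)
    have t2 := supNorm_sub_le_sub_add_sub y.1 y'.1 (blk (bj ℓ j) x'.1)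
    rw [show supNorm (y'.1 - blk (bj ℓ j) x'.1) = supNorm (blk (bj ℓ j) x'.1 - y'.1) from by
        rw [← B4TorusKernel.supNorm_neg, neg_sub]] at t2
    have hblk := supNorm_sub_le_blk hb1 x.1 x'.1
    have hp0 := supNorm_nonneg (blk (bj ℓ j) x.1 - y.1)
    have hq0 := supNorm_nonneg (y.1 - y'.1)
    have hr0 := supNorm_nonneg (blk (bj ℓ j) x'.1 - y'.1)
    have hbR : (0 : ℝ) ≤ ((bj ℓ j : ℕ) : ℝ) := Nat.cast_nonneg _
    have hsc1 := one_le_sc ℓ k j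
    have h5 : supNorm (x.1 - x'.1) ≤ ((bj ℓ j : ℕ) : ℝ) * (supNorm (blk (bj ℓ j) x.1 - y.1)
        + supNorm (y.1 - y'.1) + supNorm (blk (bj ℓ j) x'.1 - y'.1) + 1) :=
      hblk.trans (mul_le_mul_of_nonneg_left (by linarith) hbR)
    have h6 : 0 ≤ ((bj ℓ j : ℕ) : ℝ) * (supNorm (blk (bj ℓ j) x.1 - y.1)
        + supNorm (y.1 - y'.1) + supNorm (blk (bj ℓ j) x'.1 - y'.1) + 1) :=
      mul_nonneg hbR (by linarith)
    calc supNorm (x.1 - x'.1) ≤ ((bj ℓ j : ℕ) : ℝ) * (supNorm (blk (bj ℓ j) x.1 - y.1)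
          + supNorm (y.1 - y'.1) + supNorm (blk (bj ℓ j) x'.1 - y'.1) + 1) := h5
      _ = 1 * (((bj ℓ j : ℕ) : ℝ) * (supNorm (blk (bj ℓ j) x.1 - y.1)
          + supNorm (y.1 - y'.1) + supNorm (blk (bj ℓ j) x'.1 - y'.1) + 1)) := (one_mul _).symm
      _ ≤ sc ℓ k j * (((bj ℓ j : ℕ) : ℝ) * (supNorm (blk (bj ℓ j) x.1 - y.1)
          + supNorm (y.1 - y'.1) + supNorm (blk (bj ℓ j) x'.1 - y'.1) + 1)) :=
        mul_le_mul_of_nonneg_right hsc1 h6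
      _ = _ := by ring
  -- the per-term estimate
  have hterm : ∀ (x x' : ↥(boxDom (Nf ℓ k M))) (y y' : ↥(boxDom (Mj ℓ k M j))),
      |Amat ℓ k M j a m2 x y| * |Cmat ℓ k M j a m2 y y'| * |Bmat ℓ k M j a m2 y' x'|
          * Real.exp (δ₀ * supNorm (x.1 - x'.1) / (((ℓ + 1) ^ k : ℕ) : ℝ))
        ≤ ((sc ℓ k j ^ 2)⁻¹ * C₁ * ((sc ℓ k j ^ 2)⁻¹ * c₂)
            * (((((bj ℓ j : ℕ) : ℝ)) ^ (d + 1))⁻¹ * ((sc ℓ k j ^ 2)⁻¹ * C₁))) * Real.exp δ₀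
          * (Real.exp (-(κ / 2 * supNorm (blk (bj ℓ j) x.1 - y.1)))
              * Real.exp (-(δ / 2 * supNorm (y.1 - y'.1)))
              * Real.exp (-(κ / 2 * supNorm (blk (bj ℓ j) x'.1 - y'.1)))) := by
    intro x x' y y'
    have e1 := hA x y
    have e2 := hC y y'
    have e3 := hB y' x'
    have n1 : 0 ≤ (sc ℓ k j ^ 2)⁻¹ * C₁ * Real.exp (-(κ * supNorm (blk (bj ℓ j) x.1 - y.1))) :=
      mul_nonneg (mul_nonneg hsi.le hC₁) (Real.exp_pos _).le
    have n2 : 0 ≤ (sc ℓ k j ^ 2)⁻¹ * (c₂ * Real.exp (-(δ * supNorm (y.1 - y'.1)))) :=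
      mul_nonneg hsi.le (mul_nonneg hc₂.le (Real.exp_pos _).le)
    have n3 : 0 ≤ ((((bj ℓ j : ℕ) : ℝ)) ^ (d + 1))⁻¹ *
        ((sc ℓ k j ^ 2)⁻¹ * C₁ * Real.exp (-(κ * supNorm (blk (bj ℓ j) x'.1 - y'.1)))) :=
      mul_nonneg (inv_pos.2 hbD).le (mul_nonneg (mul_nonneg hsi.le hC₁) (Real.exp_pos _).le)
    have hprod := mul_le_mul (mul_le_mul e1 e2 (abs_nonneg _) n1) e3 (abs_nonneg _) (mul_nonneg n1 n2)
    have hm := exp_merge (supNorm_nonneg (blk (bj ℓ j) x.1 - y.1)) (supNorm_nonneg (y.1 - y'.1))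
      (supNorm_nonneg (blk (bj ℓ j) x'.1 - y'.1)) hδκ hδδ (hwt x x' y y')
    have hP0 : 0 ≤ (sc ℓ k j ^ 2)⁻¹ * C₁ * ((sc ℓ k j ^ 2)⁻¹ * c₂)
        * (((((bj ℓ j : ℕ) : ℝ)) ^ (d + 1))⁻¹ * ((sc ℓ k j ^ 2)⁻¹ * C₁)) :=
      mul_nonneg (mul_nonneg (mul_nonneg hsi.le hC₁) (mul_nonneg hsi.le hc₂.le))
        (mul_nonneg (inv_pos.2 hbD).le (mul_nonneg hsi.le hC₁))
    calc |Amat ℓ k M j a m2 x y| * |Cmat ℓ k M j a m2 y y'| * |Bmat ℓ k M j a m2 y' x'|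
            * Real.exp (δ₀ * supNorm (x.1 - x'.1) / (((ℓ + 1) ^ k : ℕ) : ℝ))
        ≤ ((sc ℓ k j ^ 2)⁻¹ * C₁ * Real.exp (-(κ * supNorm (blk (bj ℓ j) x.1 - y.1)))
            * ((sc ℓ k j ^ 2)⁻¹ * (c₂ * Real.exp (-(δ * supNorm (y.1 - y'.1)))))
            * (((((bj ℓ j : ℕ) : ℝ)) ^ (d + 1))⁻¹ *
                ((sc ℓ k j ^ 2)⁻¹ * C₁ * Real.exp (-(κ * supNorm (blk (bj ℓ j) x'.1 - y'.1))))))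
            * Real.exp (δ₀ * supNorm (x.1 - x'.1) / (((ℓ + 1) ^ k : ℕ) : ℝ)) :=
          mul_le_mul_of_nonneg_right hprod (Real.exp_pos _).le
      _ = ((sc ℓ k j ^ 2)⁻¹ * C₁ * ((sc ℓ k j ^ 2)⁻¹ * c₂)
            * (((((bj ℓ j : ℕ) : ℝ)) ^ (d + 1))⁻¹ * ((sc ℓ k j ^ 2)⁻¹ * C₁)))
            * (Real.exp (δ₀ * supNorm (x.1 - x'.1) / (((ℓ + 1) ^ k : ℕ) : ℝ))
              * (Real.exp (-(κ * supNorm (blk (bj ℓ j) x.1 - y.1)))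
                  * Real.exp (-(δ * supNorm (y.1 - y'.1)))
                  * Real.exp (-(κ * supNorm (blk (bj ℓ j) x'.1 - y'.1))))) := by ring
      _ ≤ ((sc ℓ k j ^ 2)⁻¹ * C₁ * ((sc ℓ k j ^ 2)⁻¹ * c₂)
            * (((((bj ℓ j : ℕ) : ℝ)) ^ (d + 1))⁻¹ * ((sc ℓ k j ^ 2)⁻¹ * C₁)))
            * (Real.exp δ₀ * (Real.exp (-(κ / 2 * supNorm (blk (bj ℓ j) x.1 - y.1)))
              * Real.exp (-(δ / 2 * supNorm (y.1 - y'.1)))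
              * Real.exp (-(κ / 2 * supNorm (blk (bj ℓ j) x'.1 - y'.1))))) :=
          mul_le_mul_of_nonneg_left hm hP0
      _ = _ := by ring
  -- the weighted row sum of `A C B`
  have hF := rho_sumBound (Mj ℓ k M j) (κ / 2) (half_pos hκ) ⟨blk (bj ℓ j) x.1, blk_bj_mem hj M x⟩
  have hsum : roww δ₀ ((ℓ + 1) ^ k) (Amat ℓ k M j a m2 * Cmat ℓ k M j a m2 * Bmat ℓ k M j a m2) x
      ≤ ((sc ℓ k j ^ 2)⁻¹ * C₁ * ((sc ℓ k j ^ 2)⁻¹ * c₂)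
            * (((((bj ℓ j : ℕ) : ℝ)) ^ (d + 1))⁻¹ * ((sc ℓ k j ^ 2)⁻¹ * C₁))) * Real.exp δ₀
          * (latticeConst (d + 1) (κ / 2) * latticeConst (d + 1) (δ / 2)
              * (((bj ℓ j : ℕ) : ℝ) ^ (d + 1) * latticeConst (d + 1) (κ / 2))) := by
    unfold roww
    calc ∑ x', |(Amat ℓ k M j a m2 * Cmat ℓ k M j a m2 * Bmat ℓ k M j a m2) x x'|
            * Real.exp (δ₀ * supNorm (x.1 - x'.1) / (((ℓ + 1) ^ k : ℕ) : ℝ))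
        ≤ ∑ x', (∑ y', ∑ y, |Amat ℓ k M j a m2 x y| * |Cmat ℓ k M j a m2 y y'|
              * |Bmat ℓ k M j a m2 y' x'|)
            * Real.exp (δ₀ * supNorm (x.1 - x'.1) / (((ℓ + 1) ^ k : ℕ) : ℝ)) := by
          refine Finset.sum_le_sum fun x' _ => mul_le_mul_of_nonneg_right ?_ (Real.exp_pos _).le
          rw [Matrix.mul_apply]
          refine (Finset.abs_sum_le_sum_abs _ _).trans (Finset.sum_le_sum fun y' _ => ?_)
          rw [Matrix.mul_apply, abs_mul]
          refine (mul_le_mul_of_nonneg_right (Finset.abs_sum_le_sum_abs _ _) (abs_nonneg _)).trans ?_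
          rw [Finset.sum_mul]
          refine Finset.sum_le_sum fun y _ => ?_
          rw [abs_mul]
      _ = ∑ x', ∑ y', ∑ y, |Amat ℓ k M j a m2 x y| * |Cmat ℓ k M j a m2 y y'|
              * |Bmat ℓ k M j a m2 y' x'|
            * Real.exp (δ₀ * supNorm (x.1 - x'.1) / (((ℓ + 1) ^ k : ℕ) : ℝ)) := by
          refine Finset.sum_congr rfl fun x' _ => ?_
          rw [Finset.sum_mul]
          refine Finset.sum_congr rfl fun y' _ => ?_
          rw [Finset.sum_mul]
      _ ≤ ∑ x' : ↥(boxDom (Nf ℓ k M)), ∑ y' : ↥(boxDom (Mj ℓ k M j)), ∑ y : ↥(boxDom (Mj ℓ k M j)),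
          ((sc ℓ k j ^ 2)⁻¹ * C₁ * ((sc ℓ k j ^ 2)⁻¹ * c₂)
            * (((((bj ℓ j : ℕ) : ℝ)) ^ (d + 1))⁻¹ * ((sc ℓ k j ^ 2)⁻¹ * C₁))) * Real.exp δ₀
          * (Real.exp (-(κ / 2 * supNorm (blk (bj ℓ j) x.1 - y.1)))
              * Real.exp (-(δ / 2 * supNorm (y.1 - y'.1)))
              * Real.exp (-(κ / 2 * supNorm (blk (bj ℓ j) x'.1 - y'.1)))) :=
          by
            apply Finset.sum_le_sum
            intro x' _
            apply Finset.sum_le_sum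
            intro y' _
            apply Finset.sum_le_sum
            intro y _
            exact hterm x x' y y'
      _ = ((sc ℓ k j ^ 2)⁻¹ * C₁ * ((sc ℓ k j ^ 2)⁻¹ * c₂)
            * (((((bj ℓ j : ℕ) : ℝ)) ^ (d + 1))⁻¹ * ((sc ℓ k j ^ 2)⁻¹ * C₁))) * Real.exp δ₀
          * ∑ x' : ↥(boxDom (Nf ℓ k M)), ∑ y' : ↥(boxDom (Mj ℓ k M j)), ∑ y : ↥(boxDom (Mj ℓ k M j)),
              Real.exp (-(κ / 2 * supNorm (blk (bj ℓ j) x.1 - y.1)))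
              * Real.exp (-(δ / 2 * supNorm (y.1 - y'.1)))
              * Real.exp (-(κ / 2 * supNorm (blk (bj ℓ j) x'.1 - y'.1))) := by
          rw [Finset.mul_sum]
          refine Finset.sum_congr rfl fun x' _ => ?_
          rw [Finset.mul_sum]
          refine Finset.sum_congr rfl fun y' _ => ?_
          rw [Finset.mul_sum]
      _ ≤ _ := by
          refine mul_le_mul_of_nonneg_left ?_ (mul_nonneg ?_ (Real.exp_pos _).le)
          · exact sum3_le (fun y : ↥(boxDom (Mj ℓ k M j)) =>
                Real.exp (-(κ / 2 * supNorm (blk (bj ℓ j) x.1 - y.1))))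
              (fun y y' : ↥(boxDom (Mj ℓ k M j)) => Real.exp (-(δ / 2 * supNorm (y.1 - y'.1))))
              (fun (y' : ↥(boxDom (Mj ℓ k M j))) (x' : ↥(boxDom (Nf ℓ k M))) =>
                Real.exp (-(κ / 2 * supNorm (blk (bj ℓ j) x'.1 - y'.1))))
              (fun _ => (Real.exp_pos _).le) (fun _ _ => (Real.exp_pos _).le) hKδ (mul_nonneg hbD.le hKκ) hF
              (fun y => rho_sumBound (Mj ℓ k M j) (δ / 2) (half_pos hδ) y)
              (fun y' => fibre_sum_le hj M (half_pos hκ) y')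
          · exact mul_nonneg (mul_nonneg (mul_nonneg hsi.le hC₁) (mul_nonneg hsi.le hc₂.le))
              (mul_nonneg (inv_pos.2 hbD).le (mul_nonneg hsi.le hC₁))
  -- assembling: `α_j² ≤ a₊²·L^{4(k-j)}`
  have hα : αj a ℓ k j ^ 2 ≤ aplus ^ 2 * (sc ℓ k j ^ 2) ^ 2 := by
    unfold αj
    rw [mul_pow]
    exact mul_le_mul_of_nonneg_right (pow_le_pow_left₀ hapos.le hw2 2) (by positivity)
  rw [Gfine_succ_sub hℓ hj1 hj hM ha0 h3, roww_smul _ _ (sq_nonneg _)]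
  calc αj a ℓ k j ^ 2 * roww δ₀ ((ℓ + 1) ^ k) (Amat ℓ k M j a m2 * Cmat ℓ k M j a m2 * Bmat ℓ k M j a m2) x
      ≤ (aplus ^ 2 * (sc ℓ k j ^ 2) ^ 2) *
          (((sc ℓ k j ^ 2)⁻¹ * C₁ * ((sc ℓ k j ^ 2)⁻¹ * c₂)
            * (((((bj ℓ j : ℕ) : ℝ)) ^ (d + 1))⁻¹ * ((sc ℓ k j ^ 2)⁻¹ * C₁))) * Real.exp δ₀
          * (latticeConst (d + 1) (κ / 2) * latticeConst (d + 1) (δ / 2)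
              * (((bj ℓ j : ℕ) : ℝ) ^ (d + 1) * latticeConst (d + 1) (κ / 2)))) :=
        mul_le_mul hα hsum (roww_nonneg _ _ _ _) (by positivity)
    _ = aplus ^ 2 * (C₁ * c₂ * C₁)
          * (latticeConst (d + 1) (κ / 2) * latticeConst (d + 1) (δ / 2) * latticeConst (d + 1) (κ / 2))
          * Real.exp δ₀ * (sc ℓ k j ^ 2)⁻¹ := by
        field_simp

end StepBound

/-! ## §9 The induction over `j`: `‖𝒢_j‖_{row,δ₀} ≤ B₁ + Θe^{δ₀}·Σ_{i<j}L^{-2(k-i)}` -/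

/-- `L^{-2(k-j)} = L^{-2}·L^{-2(k-j-1)}`. [folklore] -/
theorem sc_sq_inv_succ {ℓ k j : ℕ} (hj : j + 1 ≤ k) :
    (sc ℓ k j ^ 2)⁻¹ = (((ℓ : ℝ) + 1) ^ 2)⁻¹ * (sc ℓ k (j + 1) ^ 2)⁻¹ := by
  rw [sc_eq_succ hj, mul_pow, mul_inv]

set_option maxHeartbeats 800000 in
/-- **UNIFORM WEIGHTED ROW BOUND FOR ALL THE PROPAGATORS `𝒢_j`, `1 ≤ j ≤ k`**: there are `δ₀ > 0`, `c₀ > 0`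
(depending on `d, ℓ` and the window `[a₋,a₊] × [0,m²₊]` only) with `Σ_{x′}|𝒢_j(x,x′)|e^{δ₀|x−x′|_∞/L^k} ≤ c₀`
for every box, every `k ≥ 1` and every `1 ≤ j ≤ k` — by induction over `j` from the base (§7, through
`Gfine_apply` / `fineOp_top`) with the summable steps of §8 (`Σ_j L^{-2(k-j)} ≤ L^{-2}/(1 − L^{-2}) ≤ 1/3`). [folklore] -/
theorem Gfine_roww_bound (d ℓ : ℕ) (hℓ : 1 ≤ ℓ) (amin aplus m2plus : ℝ) (ha : 0 < amin) :
    ∃ δ₀ c₀ : ℝ, 0 < δ₀ ∧ 0 < c₀ ∧ ∀ (k : ℕ), 1 ≤ k → ∀ (j : ℕ), 1 ≤ j → j ≤ k →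
      ∀ (a m2 : ℝ), amin ≤ a → a ≤ aplus → 0 ≤ m2 → m2 ≤ m2plus → ∀ (M : Fin (d + 1) → ℕ),
        (∀ i, 1 ≤ M i) → ∀ x : ↥(boxDom (Nf ℓ k M)), roww δ₀ ((ℓ + 1) ^ k) (Gfine ℓ k M j a m2) x ≤ c₀ := by
  obtain ⟨r, C₀, hr, hC₀, hdec⟩ := boxOpR_L_inv_decay d ℓ hℓ (amin * (1 - ((((ℓ : ℝ) + 1)) ^ 2)⁻¹))
    aplus m2plus (aminus'_pos hℓ ha)
  obtain ⟨κ₀, Θ, hκ₀, hΘ, hstep⟩ := step_term_bound d ℓ hℓ amin aplus m2plus ha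
  set δ₀ : ℝ := min (r / 2) κ₀ with hδ₀
  have hδ0 : 0 < δ₀ := lt_min (half_pos hr) hκ₀
  have hδr : δ₀ ≤ r / 2 := min_le_left _ _
  have hδκ : δ₀ ≤ κ₀ := min_le_right _ _
  have hK1 := one_le_latticeConst d (half_pos hr)
  set B₁ : ℝ := C₀ * latticeConst (d + 1) (r / 2) with hB₁
  have hB₁0 : 0 < B₁ := mul_pos hC₀ (by linarith)
  refine ⟨δ₀, B₁ + Θ * Real.exp δ₀, hδ0, by positivity, ?_⟩
  intro k hk j hj1 hjk a m2 h1 h2 h3 h4 M hM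
  have ha0 : 0 < a := lt_of_lt_of_le ha h1
  have hL := one_lt_L_real hℓ
  set q : ℝ := (((ℓ : ℝ) + 1) ^ 2)⁻¹ with hq
  have hL2 : (4 : ℝ) ≤ ((ℓ : ℝ) + 1) ^ 2 := by
    have : (1 : ℝ) ≤ ℓ := by exact_mod_cast hℓ
    nlinarith
  have hq0 : 0 < q := by positivity
  have hq4 : q ≤ 1 / 4 := by
    rw [hq]
    calc (((ℓ : ℝ) + 1) ^ 2)⁻¹ ≤ (4 : ℝ)⁻¹ := by
          exact inv_anti₀ (by norm_num) hL2
      _ = 1 / 4 := by norm_num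
  have hq1 : 0 < 1 - q := by linarith
  have hnk : 1 ≤ (ℓ + 1) ^ k := Nat.one_le_pow _ _ (by omega)
  -- the inductive claim
  have main : ∀ j, 1 ≤ j → j ≤ k → ∀ x : ↥(boxDom (Nf ℓ k M)),
      roww δ₀ ((ℓ + 1) ^ k) (Gfine ℓ k M j a m2) x ≤ B₁ + Θ * Real.exp δ₀ * (q * (sc ℓ k j ^ 2)⁻¹ / (1 - q)) := by
    intro j hj1
    induction j, hj1 using Nat.le_induction with
    | base =>
      intro _ x
      obtain ⟨hw1, hw2, hapos⟩ := aSeq_window hℓ ha h1 h2 (le_refl 1)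
      have hT : ∀ x y : ↥(boxDom (Nf ℓ k M)),
          |Gfine ℓ k M 1 a m2 x y| ≤ C₀ * Real.exp (-(r * supNorm (x.1 - y.1))) := by
        intro x y
        rcases Nat.lt_or_ge k 2 with hk2 | hk2
        · obtain rfl : k = 1 := by omega
          have hG : Gfine ℓ 1 M 1 a m2 = (boxOpR ((ℓ + 1) ^ 1) (B1.aSeq a ((ℓ : ℝ) + 1) 1) m2 M)⁻¹ := by
            unfold Gfine
            rw [fineOp_top]
          rw [hG]
          exact hdec ((ℓ + 1) ^ 1) (pow_one _) _ _ hw1 hw2 h3 h4 M x y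
        · have hs : 0 < sc ℓ k 1 ^ 2 := pow_pos (sc_pos ℓ k 1) 2
          have hm' : 0 ≤ m2 / sc ℓ k 1 ^ 2 := div_nonneg h3 hs.le
          have hm'' : m2 / sc ℓ k 1 ^ 2 ≤ m2plus :=
            (div_le_self h3 (one_le_pow₀ (one_le_sc ℓ k 1))).trans h4
          rw [Gfine_apply hℓ (le_refl 1) hk2 hM ha0 h3 x y, abs_mul, abs_of_pos (inv_pos.2 hs)]
          have hd := hdec (bj ℓ 1) (pow_one _) _ _ hw1 hw2 hm' hm'' (Mj ℓ k M 1)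
            ((ej ℓ k M 1 hk2).symm x) ((ej ℓ k M 1 hk2).symm y)
          have hsi1 : (sc ℓ k 1 ^ 2)⁻¹ ≤ 1 := inv_le_one_of_one_le₀ (one_le_pow₀ (one_le_sc ℓ k 1))
          calc (sc ℓ k 1 ^ 2)⁻¹ * |(boxOpR (bj ℓ 1) (B1.aSeq a ((ℓ : ℝ) + 1) 1) (m2 / sc ℓ k 1 ^ 2)
                  (Mj ℓ k M 1))⁻¹ ((ej ℓ k M 1 hk2).symm x) ((ej ℓ k M 1 hk2).symm y)|
              ≤ 1 * (C₀ * Real.exp (-(r * supNorm (x.1 - y.1)))) :=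
                mul_le_mul hsi1 hd (abs_nonneg _) zero_le_one
            _ = _ := one_mul _
      calc roww δ₀ ((ℓ + 1) ^ k) (Gfine ℓ k M 1 a m2) x ≤ C₀ * latticeConst (d + 1) (r / 2) :=
            roww_le_of_decay hnk hC₀.le hr hδ0.le hδr hT x
        _ ≤ B₁ + Θ * Real.exp δ₀ * (q * (sc ℓ k 1 ^ 2)⁻¹ / (1 - q)) := by
            rw [hB₁]
            have : 0 ≤ Θ * Real.exp δ₀ * (q * (sc ℓ k 1 ^ 2)⁻¹ / (1 - q)) := by
              have := pow_pos (sc_pos ℓ k 1) 2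
              positivity
            linarith
    | succ j hj1 ih =>
      intro hjk x
      have hprev := ih (by omega) x
      have hst := hstep δ₀ hδ0.le hδκ k j hj1 hjk a m2 h1 h2 h3 h4 M hM x
      have hsplit : Gfine ℓ k M (j + 1) a m2
          = (Gfine ℓ k M (j + 1) a m2 - Gfine ℓ k M j a m2) + Gfine ℓ k M j a m2 := (sub_add_cancel _ _).symm
      rw [hsplit]
      calc roww δ₀ ((ℓ + 1) ^ k) ((Gfine ℓ k M (j + 1) a m2 - Gfine ℓ k M j a m2) + Gfine ℓ k M j a m2) x
          ≤ roww δ₀ ((ℓ + 1) ^ k) (Gfine ℓ k M (j + 1) a m2 - Gfine ℓ k M j a m2) x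
              + roww δ₀ ((ℓ + 1) ^ k) (Gfine ℓ k M j a m2) x := roww_add_le _ _ _ _ _
        _ ≤ Θ * Real.exp δ₀ * (sc ℓ k j ^ 2)⁻¹ + (B₁ + Θ * Real.exp δ₀ * (q * (sc ℓ k j ^ 2)⁻¹ / (1 - q))) :=
            add_le_add hst hprev
        _ = B₁ + Θ * Real.exp δ₀ * (q * (sc ℓ k (j + 1) ^ 2)⁻¹ / (1 - q)) := by
            rw [sc_sq_inv_succ hjk, ← hq]
            field_simp
            ring
  intro x
  have hm := main j hj1 hjk x
  have hs1 : (sc ℓ k j ^ 2)⁻¹ ≤ 1 := inv_le_one_of_one_le₀ (one_le_pow₀ (one_le_sc ℓ k j))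
  have hs0 : 0 < (sc ℓ k j ^ 2)⁻¹ := inv_pos.2 (pow_pos (sc_pos ℓ k j) 2)
  have hgeo : q * (sc ℓ k j ^ 2)⁻¹ / (1 - q) ≤ 1 := by
    rw [div_le_one hq1]
    calc q * (sc ℓ k j ^ 2)⁻¹ ≤ q * 1 := mul_le_mul_of_nonneg_left hs1 hq0.le
      _ ≤ 1 - q := by linarith
  have hΘe : 0 ≤ Θ * Real.exp δ₀ := by positivity
  have hfin := mul_le_of_le_one_right hΘe hgeo
  linarith

/-! ## §10 THEOREM (1.10) of [B4] at `A = 0` for boxes: the decay of `G(□) = 𝒢_k` -/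

/-- **[B4] p. 573 THEOREM, inequality (1.10), VALUE CLAUSE, at `A = 0`, for rectangular parallelepipeds `Ω = □`**
(weighted-row form, which is slightly stronger than the pointwise statement): there are `δ₀ > 0`, `c₀ > 0`
depending only on `d`, `L = ℓ + 1` and the window such that for every `k ≥ 1` (lattice spacing `L^{-k}`), every
`(a, m²)` in the window, every box `□` of side lengths `M_μ` (`M_μ ≥ 1`, in `L^{-k}`-units `L^kM_μ` points) and
every point `x`,  `Σ_{x′ ∈ □} |G(□; x, x′)|·e^{δ₀·dist(x,x′)} ≤ c₀`,  where `G(□) = (L^{2k}(−Δ^N_□) + m² + a_kP_k)^{-1}`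
is the propagator (1.9) at `A = 0` in values form (`= 𝒢_k` of (2.34), `fineOp_top`) and `dist = |·|_∞/L^k` is the
sup-distance in the print's units. HONEST LABEL: proved here from the Literature leaves B4BoxCov237 ((2.37) for
boxes) and B1RG242 ((2.42)), by the argument of [B4] pp. 582–583 ((2.34)–(2.37)) — not a quotation of the print's
own proof of Proposition 2.1. [cite: Balaban1983RegularityDecay, p. 573 Theorem (1.10); pp. 582–583 (2.34)–(2.37)] -/
theorem thm110_zero_box_roww (d ℓ : ℕ) (hℓ : 1 ≤ ℓ) (amin aplus m2plus : ℝ) (ha : 0 < amin) :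
    ∃ δ₀ c₀ : ℝ, 0 < δ₀ ∧ 0 < c₀ ∧ ∀ (k : ℕ), 1 ≤ k → ∀ (a m2 : ℝ), amin ≤ a → a ≤ aplus → 0 ≤ m2 →
      m2 ≤ m2plus → ∀ (M : Fin (d + 1) → ℕ), (∀ i, 1 ≤ M i) →
        ∀ x : ↥(boxDom (fun i => (ℓ + 1) ^ k * M i)),
          ∑ x', |(boxOpR ((ℓ + 1) ^ k) (B1.aSeq a ((ℓ : ℝ) + 1) k) m2 M)⁻¹ x x'|
              * Real.exp (δ₀ * supNorm (x.1 - x'.1) / (((ℓ + 1) ^ k : ℕ) : ℝ)) ≤ c₀ := by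
  obtain ⟨δ₀, c₀, hδ, hc, h⟩ := Gfine_roww_bound d ℓ hℓ amin aplus m2plus ha
  refine ⟨δ₀, c₀, hδ, hc, fun k hk a m2 h1 h2 h3 h4 M hM x => ?_⟩
  have hG : Gfine ℓ k M k a m2 = (boxOpR ((ℓ + 1) ^ k) (B1.aSeq a ((ℓ : ℝ) + 1) k) m2 M)⁻¹ := by
    unfold Gfine
    rw [fineOp_top]
  have := h k hk k hk le_rfl a m2 h1 h2 h3 h4 M hM x
  rw [roww, hG] at this
  exact this


/-! ## §11 The printed forms: the value clause of (1.10), Lemma 2.2 (2.16)/(2.17) at `p = q ∈ {1, ∞}`, and the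
literal coefficient `a` of (1.6) -/

section Corollaries

variable {N : Fin (d + 1) → ℕ}

/-- the `ℓ^∞` distance, in fine-lattice units, from the site `x` to the support of `f` (the printed
`η^{-1}·dist(x, supp f)`); the junk value `0` when `f = 0`. [folklore] -/
def dsupp (f : ↥(boxDom N) → ℝ) (x : ↥(boxDom N)) : ℝ :=
  if h : (Finset.univ.filter fun x' : ↥(boxDom N) => f x' ≠ 0).Nonempty then
    (Finset.univ.filter fun x' : ↥(boxDom N) => f x' ≠ 0).inf' h (fun x' => supNorm (x.1 - x'.1))
  else 0

/-- `dist(x, supp f) ≥ 0`. [folklore] -/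
theorem dsupp_nonneg (f : ↥(boxDom N) → ℝ) (x : ↥(boxDom N)) : 0 ≤ dsupp f x := by
  unfold dsupp
  split_ifs with h
  · exact Finset.le_inf' _ _ fun x' _ => supNorm_nonneg _
  · exact le_rfl

/-- `dist(x, supp f) ≤ |x − x'|_∞` for every `x'` in the support. [folklore] -/
theorem dsupp_le (f : ↥(boxDom N) → ℝ) (x x' : ↥(boxDom N)) (hx' : f x' ≠ 0) :
    dsupp f x ≤ supNorm (x.1 - x'.1) := by
  unfold dsupp
  have hmem : x' ∈ Finset.univ.filter fun z : ↥(boxDom N) => f z ≠ 0 :=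
    Finset.mem_filter.2 ⟨Finset.mem_univ _, hx'⟩
  rw [dif_pos ⟨x', hmem⟩]
  exact Finset.inf'_le _ hmem

/-- **FROM THE WEIGHTED ROW NORM TO THE PRINTED VALUE BOUND**: if `Σ_{x'}|T(x,x')|e^{δ₀|x−x'|_∞/n} ≤ c₀`,
`|f| ≤ F` pointwise and `D ≤ |x − x'|_∞` on the support of `f`, then `|(Tf)(x)| ≤ c₀e^{−δ₀D/n}F`. [folklore] -/
theorem mulVec_le_of_roww {δ₀ c₀ : ℝ} (hδ : 0 ≤ δ₀) (n : ℕ) (T : Matrix ↥(boxDom N) ↥(boxDom N) ℝ)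
    (x : ↥(boxDom N)) (hrow : roww δ₀ n T x ≤ c₀) (f : ↥(boxDom N) → ℝ) {F D : ℝ}
    (hF : ∀ x', |f x'| ≤ F) (hD : ∀ x', f x' ≠ 0 → D ≤ supNorm (x.1 - x'.1)) :
    |(T *ᵥ f) x| ≤ c₀ * Real.exp (-(δ₀ * D / n)) * F := by
  have hF0 : 0 ≤ F := (abs_nonneg _).trans (hF x)
  have h1 : |(T *ᵥ f) x| ≤ ∑ x', |T x x'| * |f x'| := by
    simp only [Matrix.mulVec, dotProduct]
    exact (Finset.abs_sum_le_sum_abs _ _).trans (le_of_eq (Finset.sum_congr rfl fun x' _ => abs_mul _ _))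
  have h2 : ∀ x', |T x x'| * |f x'|
      ≤ |T x x'| * Real.exp (δ₀ * supNorm (x.1 - x'.1) / n) * (Real.exp (-(δ₀ * D / n)) * F) := by
    intro x'
    by_cases hfx : f x' = 0
    · rw [hfx, abs_zero, mul_zero]
      positivity
    · have hDx := hD x' hfx
      have he : 1 ≤ Real.exp (δ₀ * supNorm (x.1 - x'.1) / n) * Real.exp (-(δ₀ * D / n)) := by
        rw [← Real.exp_add]
        apply Real.one_le_exp
        have h0 : 0 ≤ δ₀ * (supNorm (x.1 - x'.1) - D) / n :=
          div_nonneg (mul_nonneg hδ (sub_nonneg.2 hDx)) n.cast_nonneg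
        have heq : δ₀ * supNorm (x.1 - x'.1) / n + -(δ₀ * D / n) = δ₀ * (supNorm (x.1 - x'.1) - D) / n := by
          ring
        rw [heq]
        exact h0
      calc |T x x'| * |f x'| ≤ |T x x'| * F := mul_le_mul_of_nonneg_left (hF x') (abs_nonneg _)
        _ ≤ |T x x'| * F * (Real.exp (δ₀ * supNorm (x.1 - x'.1) / n) * Real.exp (-(δ₀ * D / n))) :=
            le_mul_of_one_le_right (mul_nonneg (abs_nonneg _) hF0) he
        _ = _ := by ring
  calc |(T *ᵥ f) x| ≤ ∑ x', |T x x'| * |f x'| := h1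
    _ ≤ ∑ x', |T x x'| * Real.exp (δ₀ * supNorm (x.1 - x'.1) / n) * (Real.exp (-(δ₀ * D / n)) * F) :=
        Finset.sum_le_sum fun x' _ => h2 x'
    _ = roww δ₀ n T x * (Real.exp (-(δ₀ * D / n)) * F) := by rw [roww, Finset.sum_mul]
    _ ≤ c₀ * (Real.exp (-(δ₀ * D / n)) * F) := mul_le_mul_of_nonneg_right hrow (by positivity)
    _ = c₀ * Real.exp (-(δ₀ * D / n)) * F := by ring

/-- the weighted row norm dominates the plain column sum of a SYMMETRIC kernel. [folklore] -/
theorem colSum_le_roww {δ₀ : ℝ} (hδ : 0 ≤ δ₀) (n : ℕ) {T : Matrix ↥(boxDom N) ↥(boxDom N) ℝ} (hT : T.IsSymm)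
    (x' : ↥(boxDom N)) : ∑ x, |T x x'| ≤ roww δ₀ n T x' := by
  have h : ∀ x, T x x' = T x' x := fun x => hT.apply x' x
  simp_rw [h]
  exact rowSum_le_roww hδ n T x'

end Corollaries

/-- **THEOREM (1.10) OF [B4] AT `A = 0` FOR RECTANGULAR PARALLELEPIPEDS — THE PRINTED VALUE CLAUSE**
`|(G_k(□)f)(x)| ≤ c₀ exp(−δ₀ dist(x, supp f))‖f‖_∞` for ALL `x ∈ □` («for rectangular parallelepipeds, the
inequalities hold without any restrictions on the points», p. 573): there are `δ₀ > 0`, `c₀ > 0` depending only on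
`d`, `ℓ` and the window such that for every `k ≥ 1` (`η = L^{-k}`), `(a, m²)` in the window, every box
`□ = Π_μ[0, M_μ)` (`M_μ ≥ 1`), every `f : □ ∩ ηℤ^{d+1} → ℝ`, every bound `F ≥ |f|` and every `D` with
`D ≤ |x − x'|_∞` for all `x' ∈ supp f` (distances in fine-lattice units, so `ηD ≤ dist_∞(x, supp f)`):
`|(G f)(x)| ≤ c₀·e^{−δ₀ηD}·F`, `G = (−Δ^{η,N}_□ + m² + a_kP_k)^{-1}` (`a ↤ a_k`, DICTIONARY in the header).
[cite: Balaban1983RegularityDecay, Theorem (Prop. 2.1 of [1]) (1.10) p.573] -/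
theorem thm110_zero_box_value (d ℓ : ℕ) (hℓ : 1 ≤ ℓ) (amin aplus m2plus : ℝ) (ha : 0 < amin) :
    ∃ δ₀ c₀ : ℝ, 0 < δ₀ ∧ 0 < c₀ ∧ ∀ (k : ℕ), 1 ≤ k → ∀ (a m2 : ℝ), amin ≤ a → a ≤ aplus → 0 ≤ m2 →
      m2 ≤ m2plus → ∀ (M : Fin (d + 1) → ℕ), (∀ i, 1 ≤ M i) →
      ∀ (f : ↥(boxDom (fun i => (ℓ + 1) ^ k * M i)) → ℝ) (F D : ℝ), (∀ x', |f x'| ≤ F) →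
      ∀ x : ↥(boxDom (fun i => (ℓ + 1) ^ k * M i)), (∀ x', f x' ≠ 0 → D ≤ supNorm (x.1 - x'.1)) →
        |((boxOpR ((ℓ + 1) ^ k) (B1.aSeq a ((ℓ : ℝ) + 1) k) m2 M)⁻¹ *ᵥ f) x|
          ≤ c₀ * Real.exp (-(δ₀ * D / (((ℓ + 1) ^ k : ℕ) : ℝ))) * F := by
  obtain ⟨δ₀, c₀, hδ0, hc0, h⟩ := thm110_zero_box_roww d ℓ hℓ amin aplus m2plus ha
  refine ⟨δ₀, c₀, hδ0, hc0, ?_⟩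
  intro k hk a m2 h1 h2 h3 h4 M hM f F D hF x hD
  exact mulVec_le_of_roww hδ0.le _ _ x (h k hk a m2 h1 h2 h3 h4 M hM x) f hF hD

/-- **THE SAME WITH THE LITERAL `dist(x, supp f)`** (`dsupp f x` = the `ℓ^∞` distance from `x` to `supp f` in
fine-lattice units; `e^{−δ₀·dsupp/L^k} = e^{−δ₀ dist_η(x, supp f)}`): `|(G f)(x)| ≤ c₀e^{−δ₀η·dsupp f x}·F` for every
`F ≥ |f|`. [cite: Balaban1983RegularityDecay, Theorem (Prop. 2.1 of [1]) (1.10) p.573] -/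
theorem thm110_zero_box_dist (d ℓ : ℕ) (hℓ : 1 ≤ ℓ) (amin aplus m2plus : ℝ) (ha : 0 < amin) :
    ∃ δ₀ c₀ : ℝ, 0 < δ₀ ∧ 0 < c₀ ∧ ∀ (k : ℕ), 1 ≤ k → ∀ (a m2 : ℝ), amin ≤ a → a ≤ aplus → 0 ≤ m2 →
      m2 ≤ m2plus → ∀ (M : Fin (d + 1) → ℕ), (∀ i, 1 ≤ M i) →
      ∀ (f : ↥(boxDom (fun i => (ℓ + 1) ^ k * M i)) → ℝ) (F : ℝ), (∀ x', |f x'| ≤ F) →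
      ∀ x : ↥(boxDom (fun i => (ℓ + 1) ^ k * M i)),
        |((boxOpR ((ℓ + 1) ^ k) (B1.aSeq a ((ℓ : ℝ) + 1) k) m2 M)⁻¹ *ᵥ f) x|
          ≤ c₀ * Real.exp (-(δ₀ * dsupp f x / (((ℓ + 1) ^ k : ℕ) : ℝ))) * F := by
  obtain ⟨δ₀, c₀, hδ0, hc0, h⟩ := thm110_zero_box_value d ℓ hℓ amin aplus m2plus ha
  refine ⟨δ₀, c₀, hδ0, hc0, ?_⟩
  intro k hk a m2 h1 h2 h3 h4 M hM f F hF x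
  exact h k hk a m2 h1 h2 h3 h4 M hM f F (dsupp f x) hF x fun x' hx' => dsupp_le f x x' hx'

/-- **LEMMA 2.2 (2.17) AT `A = 0`, `p = q = ∞`** (and the `sup|·|` part of (2.16)): `‖G_k(□)‖_{∞→∞} ≤ c₀`, i.e.
`Σ_{x'}|G(x,x')| ≤ c₀` for every `x`, uniformly in `k ≥ 1`, the window and the box.
[cite: Balaban1983RegularityDecay, Lemma 2.2 (2.16)–(2.17) p.577–578] -/
theorem lemma22_zero_box_rowSum (d ℓ : ℕ) (hℓ : 1 ≤ ℓ) (amin aplus m2plus : ℝ) (ha : 0 < amin) :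
    ∃ c₀ : ℝ, 0 < c₀ ∧ ∀ (k : ℕ), 1 ≤ k → ∀ (a m2 : ℝ), amin ≤ a → a ≤ aplus → 0 ≤ m2 →
      m2 ≤ m2plus → ∀ (M : Fin (d + 1) → ℕ), (∀ i, 1 ≤ M i) →
      ∀ x : ↥(boxDom (fun i => (ℓ + 1) ^ k * M i)),
        ∑ x', |(boxOpR ((ℓ + 1) ^ k) (B1.aSeq a ((ℓ : ℝ) + 1) k) m2 M)⁻¹ x x'| ≤ c₀ := by
  obtain ⟨δ₀, c₀, hδ0, hc0, h⟩ := thm110_zero_box_roww d ℓ hℓ amin aplus m2plus ha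
  refine ⟨c₀, hc0, ?_⟩
  intro k hk a m2 h1 h2 h3 h4 M hM x
  exact (rowSum_le_roww hδ0.le _ _ x).trans (h k hk a m2 h1 h2 h3 h4 M hM x)

/-- **LEMMA 2.2 (2.17) AT `A = 0`, `p = q = 1`**: `‖G_k(□)‖_{1→1} ≤ c₀`, i.e. `Σ_{x}|G(x,x')| ≤ c₀` for every `x'`
(symmetry of `G`, `B4BoxCov237.boxOpR_inv_isSymm`). [cite: Balaban1983RegularityDecay, Lemma 2.2 (2.17) p.578] -/
theorem lemma22_zero_box_colSum (d ℓ : ℕ) (hℓ : 1 ≤ ℓ) (amin aplus m2plus : ℝ) (ha : 0 < amin) :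
    ∃ c₀ : ℝ, 0 < c₀ ∧ ∀ (k : ℕ), 1 ≤ k → ∀ (a m2 : ℝ), amin ≤ a → a ≤ aplus → 0 ≤ m2 →
      m2 ≤ m2plus → ∀ (M : Fin (d + 1) → ℕ), (∀ i, 1 ≤ M i) →
      ∀ x' : ↥(boxDom (fun i => (ℓ + 1) ^ k * M i)),
        ∑ x, |(boxOpR ((ℓ + 1) ^ k) (B1.aSeq a ((ℓ : ℝ) + 1) k) m2 M)⁻¹ x x'| ≤ c₀ := by
  obtain ⟨δ₀, c₀, hδ0, hc0, h⟩ := thm110_zero_box_roww d ℓ hℓ amin aplus m2plus ha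
  refine ⟨c₀, hc0, ?_⟩
  intro k hk a m2 h1 h2 h3 h4 M hM x'
  exact (colSum_le_roww hδ0.le _ (boxOpR_inv_isSymm _ _ _ _) x').trans (h k hk a m2 h1 h2 h3 h4 M hM x')

/-- **`‖G_k(□)f‖_∞ ≤ c₀‖f‖_∞`** — (2.16)/(2.17) at `A = 0` in the printed operator form (`D = 0` in the value
bound). [cite: Balaban1983RegularityDecay, Lemma 2.2 (2.16)–(2.17) p.577–578] -/
theorem lemma22_zero_box_sup (d ℓ : ℕ) (hℓ : 1 ≤ ℓ) (amin aplus m2plus : ℝ) (ha : 0 < amin) :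
    ∃ c₀ : ℝ, 0 < c₀ ∧ ∀ (k : ℕ), 1 ≤ k → ∀ (a m2 : ℝ), amin ≤ a → a ≤ aplus → 0 ≤ m2 →
      m2 ≤ m2plus → ∀ (M : Fin (d + 1) → ℕ), (∀ i, 1 ≤ M i) →
      ∀ (f : ↥(boxDom (fun i => (ℓ + 1) ^ k * M i)) → ℝ) (F : ℝ), (∀ x', |f x'| ≤ F) →
      ∀ x : ↥(boxDom (fun i => (ℓ + 1) ^ k * M i)),
        |((boxOpR ((ℓ + 1) ^ k) (B1.aSeq a ((ℓ : ℝ) + 1) k) m2 M)⁻¹ *ᵥ f) x| ≤ c₀ * F := by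
  obtain ⟨δ₀, c₀, hδ0, hc0, h⟩ := thm110_zero_box_value d ℓ hℓ amin aplus m2plus ha
  refine ⟨c₀, hc0, ?_⟩
  intro k hk a m2 h1 h2 h3 h4 M hM f F hF x
  have := h k hk a m2 h1 h2 h3 h4 M hM f F 0 hF x fun x' _ => supNorm_nonneg _
  simpa using this

/-! ### The literal coefficient `a` of (1.6)

B4 (1.6) writes `G_k(Ω, A) = (−Δ^{η,N}_{A,Ω} + m² + aP_k(A))^{-1}` with a generic `a` «close to 1», while §2 of the
paper ((2.24), (2.44)) and the renormalization group equations of [1] carry the running `a_k`, `m_k²`; the main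
theorem is stated through `a_k = B1.aSeq a L k = a·c_k`, `c_k = (1 − L^{-2})/(1 − L^{-2k}) ∈ [1 − L^{-2}, 1]`
(B1 (2.15)). Since `a ↦ a_k` is a linear bijection of `]0, ∞[`, the bound holds equally for the LITERAL coefficient
ranging over any window `[a₋, a₊]` — with the constants of the window `[a₋, a₊/(1 − L^{-2})]`. -/

/-- `c_k = (1 − L^{-2})/(1 − L^{-2k})`, the ratio `a_k/a` of B1 (2.15). [cite: Balaban1982Higgs1, (2.15) p.609] -/
def cK (ℓ k : ℕ) : ℝ := (1 - ((((ℓ : ℝ) + 1)) ^ 2)⁻¹) / (1 - (((((ℓ : ℝ) + 1)) ^ 2)⁻¹) ^ k)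

/-- `0 < L^{-2} < 1` for `L = ℓ + 1 ≥ 2`. [folklore] -/
theorem Linv_sq_bounds {ℓ : ℕ} (hℓ : 1 ≤ ℓ) : 0 < ((((ℓ : ℝ) + 1)) ^ 2)⁻¹ ∧ ((((ℓ : ℝ) + 1)) ^ 2)⁻¹ < 1 := by
  have hL := one_lt_L_real hℓ
  have h2 : 1 < (((ℓ : ℝ) + 1)) ^ 2 := by nlinarith
  exact ⟨by positivity, inv_lt_one_of_one_lt₀ h2⟩

/-- `c_k > 0` (`k ≥ 1`). [folklore] -/
theorem cK_pos {ℓ k : ℕ} (hℓ : 1 ≤ ℓ) (hk : 1 ≤ k) : 0 < cK ℓ k := by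
  obtain ⟨hr0, hr1⟩ := Linv_sq_bounds hℓ
  have hk' : (((((ℓ : ℝ) + 1)) ^ 2)⁻¹) ^ k < 1 := pow_lt_one₀ hr0.le hr1 (by omega)
  unfold cK
  exact div_pos (by linarith) (by linarith)

/-- `c_k ≤ 1` (`k ≥ 1`). [folklore] -/
theorem cK_le_one {ℓ k : ℕ} (hℓ : 1 ≤ ℓ) (hk : 1 ≤ k) : cK ℓ k ≤ 1 := by
  obtain ⟨hr0, hr1⟩ := Linv_sq_bounds hℓ
  have hk' : (((((ℓ : ℝ) + 1)) ^ 2)⁻¹) ^ k < 1 := pow_lt_one₀ hr0.le hr1 (by omega)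
  have hle : (((((ℓ : ℝ) + 1)) ^ 2)⁻¹) ^ k ≤ ((((ℓ : ℝ) + 1)) ^ 2)⁻¹ := pow_le_of_le_one hr0.le hr1.le (by omega)
  unfold cK
  rw [div_le_one (by linarith)]
  linarith

/-- `1 − L^{-2} ≤ c_k` (`k ≥ 1`). [folklore] -/
theorem oneSub_le_cK {ℓ k : ℕ} (hℓ : 1 ≤ ℓ) (hk : 1 ≤ k) : 1 - ((((ℓ : ℝ) + 1)) ^ 2)⁻¹ ≤ cK ℓ k := by
  obtain ⟨hr0, hr1⟩ := Linv_sq_bounds hℓ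
  have hk' : (((((ℓ : ℝ) + 1)) ^ 2)⁻¹) ^ k < 1 := pow_lt_one₀ hr0.le hr1 (by omega)
  have hpk : 0 ≤ (((((ℓ : ℝ) + 1)) ^ 2)⁻¹) ^ k := pow_nonneg hr0.le k
  unfold cK
  rw [le_div_iff₀ (by linarith)]
  nlinarith

/-- `a_k = a·c_k`, hence `aSeq (a'/c_k) L k = a'`: every literal coefficient is a running one.
[cite: Balaban1982Higgs1, (2.15) p.609] -/
theorem aSeq_div_cK {ℓ k : ℕ} (hℓ : 1 ≤ ℓ) (hk : 1 ≤ k) (a' : ℝ) :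
    B1.aSeq (a' / cK ℓ k) ((ℓ : ℝ) + 1) k = a' := by
  have hc : cK ℓ k ≠ 0 := (cK_pos hℓ hk).ne'
  rw [B1.aSeq_eq, mul_div_assoc]
  show a' / cK ℓ k * cK ℓ k = a'
  exact div_mul_cancel₀ a' hc

/-- **THEOREM (1.10) AT `A = 0` FOR BOXES WITH THE LITERAL COEFFICIENT `a` OF (1.6)**: the uniform weighted row
bound for `G = (−Δ^{η,N}_□ + m² + aP_k)^{-1}` itself, `a` ranging over the window `[a₋, a₊]`, `m² ∈ [0, m²₊]`.
[cite: Balaban1983RegularityDecay, Theorem (Prop. 2.1 of [1]) (1.10) p.573 with (1.6) p.572] -/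
theorem thm110_zero_box_roww_coeff (d ℓ : ℕ) (hℓ : 1 ≤ ℓ) (amin aplus m2plus : ℝ) (ha : 0 < amin) :
    ∃ δ₀ c₀ : ℝ, 0 < δ₀ ∧ 0 < c₀ ∧ ∀ (k : ℕ), 1 ≤ k → ∀ (a m2 : ℝ), amin ≤ a → a ≤ aplus → 0 ≤ m2 →
      m2 ≤ m2plus → ∀ (M : Fin (d + 1) → ℕ), (∀ i, 1 ≤ M i) → ∀ x : ↥(boxDom (fun i => (ℓ + 1) ^ k * M i)),
        ∑ x', |(boxOpR ((ℓ + 1) ^ k) a m2 M)⁻¹ x x'|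
            * Real.exp (δ₀ * supNorm (x.1 - x'.1) / (((ℓ + 1) ^ k : ℕ) : ℝ)) ≤ c₀ := by
  obtain ⟨hr0, hr1⟩ := Linv_sq_bounds hℓ
  obtain ⟨δ₀, c₀, hδ0, hc0, h⟩ :=
    thm110_zero_box_roww d ℓ hℓ amin (aplus / (1 - ((((ℓ : ℝ) + 1)) ^ 2)⁻¹)) m2plus ha
  refine ⟨δ₀, c₀, hδ0, hc0, ?_⟩
  intro k hk a m2 h1 h2 h3 h4 M hM x
  have hc := cK_pos hℓ hk
  have hA1 : amin ≤ a / cK ℓ k := by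
    rw [le_div_iff₀ hc]
    calc amin * cK ℓ k ≤ amin * 1 := mul_le_mul_of_nonneg_left (cK_le_one hℓ hk) ha.le
      _ ≤ a := by linarith
  have hA2 : a / cK ℓ k ≤ aplus / (1 - ((((ℓ : ℝ) + 1)) ^ 2)⁻¹) :=
    div_le_div₀ (by linarith) h2 (by linarith) (oneSub_le_cK hℓ hk)
  have := h k hk (a / cK ℓ k) m2 hA1 hA2 h3 h4 M hM x
  rwa [aSeq_div_cK hℓ hk] at this

/-- … and the corresponding printed value clause with the literal coefficient.
[cite: Balaban1983RegularityDecay, Theorem (Prop. 2.1 of [1]) (1.10) p.573 with (1.6) p.572] -/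
theorem thm110_zero_box_value_coeff (d ℓ : ℕ) (hℓ : 1 ≤ ℓ) (amin aplus m2plus : ℝ) (ha : 0 < amin) :
    ∃ δ₀ c₀ : ℝ, 0 < δ₀ ∧ 0 < c₀ ∧ ∀ (k : ℕ), 1 ≤ k → ∀ (a m2 : ℝ), amin ≤ a → a ≤ aplus → 0 ≤ m2 →
      m2 ≤ m2plus → ∀ (M : Fin (d + 1) → ℕ), (∀ i, 1 ≤ M i) →
      ∀ (f : ↥(boxDom (fun i => (ℓ + 1) ^ k * M i)) → ℝ) (F D : ℝ), (∀ x', |f x'| ≤ F) →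
      ∀ x : ↥(boxDom (fun i => (ℓ + 1) ^ k * M i)), (∀ x', f x' ≠ 0 → D ≤ supNorm (x.1 - x'.1)) →
        |((boxOpR ((ℓ + 1) ^ k) a m2 M)⁻¹ *ᵥ f) x|
          ≤ c₀ * Real.exp (-(δ₀ * D / (((ℓ + 1) ^ k : ℕ) : ℝ))) * F := by
  obtain ⟨δ₀, c₀, hδ0, hc0, h⟩ := thm110_zero_box_roww_coeff d ℓ hℓ amin aplus m2plus ha
  refine ⟨δ₀, c₀, hδ0, hc0, ?_⟩
  intro k hk a m2 h1 h2 h3 h4 M hM f F D hF x hD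
  exact mulVec_le_of_roww hδ0.le _ _ x (h k hk a m2 h1 h2 h3 h4 M hM x) f hF hD

/-! ## §12 Non-vacuity: the hypotheses are met (`d + 1 = 4`, `L = 2`, window `a ∈ [1/2, 2]`, `m² ∈ [0, 1]`) -/

/-- the main theorem at the physical dimension `d + 1 = 4`, `L = 2`. -/
example : ∃ δ₀ c₀ : ℝ, 0 < δ₀ ∧ 0 < c₀ ∧ ∀ (k : ℕ), 1 ≤ k → ∀ (a m2 : ℝ), (1 / 2 : ℝ) ≤ a → a ≤ 2 → 0 ≤ m2 →
      m2 ≤ 1 → ∀ (M : Fin (3 + 1) → ℕ), (∀ i, 1 ≤ M i) → ∀ x : ↥(boxDom (fun i => (1 + 1) ^ k * M i)),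
        ∑ x', |(boxOpR ((1 + 1) ^ k) a m2 M)⁻¹ x x'|
            * Real.exp (δ₀ * supNorm (x.1 - x'.1) / (((1 + 1) ^ k : ℕ) : ℝ)) ≤ c₀ :=
  thm110_zero_box_roww_coeff 3 1 le_rfl (1 / 2) 2 1 (by norm_num)

/-- the quantifier prefix of the theorems is inhabited: `k = 1`, `a = 1`, `m² = 0`, the unit cube `M ≡ 1`, and the
fine box is non-empty (it contains the origin). -/
example : (1 : ℕ) ≤ 1 ∧ (1 / 2 : ℝ) ≤ 1 ∧ (1 : ℝ) ≤ 2 ∧ (0 : ℝ) ≤ 0 ∧ (0 : ℝ) ≤ 1 ∧ (∀ i : Fin (3 + 1), 1 ≤ (fun _ => 1 : Fin (3 + 1) → ℕ) i)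
    ∧ (fun _ => (0 : ℤ)) ∈ boxDom (fun i : Fin (3 + 1) => (1 + 1) ^ 1 * (fun _ => 1 : Fin (3 + 1) → ℕ) i) := by
  refine ⟨le_rfl, by norm_num, by norm_num, le_rfl, by norm_num, fun _ => le_rfl, ?_⟩
  exact mem_boxDom.2 fun _ => ⟨le_rfl, by norm_num⟩
end

end Literature.MathematicalPhysics.QuantumFieldTheory.Balaban1983to89.B4Thm110ZeroBox
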